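import Summits.HodgeConjecture.HodgeConjecture.Cruxes.H413.Lines.F0_P2CELocalToGlobal      -- PK BY NAME (`StubPKLocalThetaClasses`, junction OWNER K2E1) + sorry-free folds `stubCE_of_rung2`, `stub_GL_globalLine`, …
import Summits.HodgeConjecture.HodgeConjecture.Cruxes.H413.Lines.F0_P2E3ParityRecut        -- E3♭ BY NAME (`StubE3FlatAutomorphicParity`, junction OWNER K2E1 via REL♯¹)
import Summits.HodgeConjecture.HodgeConjecture.Theorems.F0P2cSocketC                      -- ★ `cohFinComponentIsThetaAdm_of_CE` ((C♭) ⟸ CE; CL, CF, CI ★)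
import Summits.HodgeConjecture.HodgeConjecture.Theorems.F0P3AutomorphicFlathAdmissibleOfCot   -- ★ «AFA» `exists_irreducible_admissible_hasFinComponent_of_isHolCotangentAt`
import Summits.HodgeConjecture.HodgeConjecture.Theorems.K2E2OrAntiholWitnessOfNeg           -- ★ socket #18 CLOSER (p855379, K2E2-p03): `orAntiholWitnessOfNeg` — RE-TIES `stub_antiholWitnessOfNeg` (ED. 7)
import Summits.HodgeConjecture.HodgeConjecture.Theorems.F0P2tThetaPairNeZeroOfFrame            -- ★ (N5) vocabulary for stub ARCH
import Summits.HodgeConjecture.HodgeConjecture.Theorems.K2E2CapHolThetaWitnessOrientedOfArchRows   -- ★ p855353 (K2E2-p12): `capHolThetaWitnessOriented_of_archRowsGen : ‹ARCH-ROWS-GEN› → ‹#12R›` — FOLDS stub R12 onto ARCH-ROWS-GEN (ED. 8)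
import Summits.HodgeConjecture.HodgeConjecture.Theorems.K2E2CapArchRowsGenOfAllThetaData      -- ★ p855525 (K2E2-p12): `archRowsGen_of_forall_thetaData : ‹ARCH-ROWS-ALLDATA› → ‹ARCH-ROWS-GEN›` (ED. 8)
import Summits.HodgeConjecture.HodgeConjecture.Theorems.K2E2CapArchRowsAllDataOfPairHolCot      -- ★ p855623 (K2E2-p12): `archRowsAllData_of_pairHolCot : ‹ARCH-PAIR-HOLCOT› → ‹ARCH-ROWS-ALLDATA›` — FOLDS ARCH-ROWS-GEN onto stub ARCH-PAIR-HOLCOT (ED. 8)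
import Summits.HodgeConjecture.HodgeConjecture.Theorems.K2E2CapArchPairHolCot   -- ★ p857161: `capArchPairHolCot : ‹#20a›` (ED. 9 fold by name)
import Summits.HodgeConjecture.HodgeConjecture.Theorems.K2E2CapThetaClassCaptureOriented     -- ★ socket #13R FOLD (p855041): `capThetaClassCaptureOriented_of : ‹#12R› → ‹#10› → ‹#13R›` — RE-TIES `stub_thetaClassCaptureR` MODULO #12R (ED. 6)
import Summits.HodgeConjecture.HodgeConjecture.Theorems.K2E2L2MemOfProjectionRigidity        -- ★ socket #10 (p854820): `memOfProjectionRigidity` BY NAME (ED. 6)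
import Summits.HodgeConjecture.HodgeConjecture.Theorems.K2E2TrFinComponentTransport          -- ★ socket #8 CLOSER (p854824): `finComponentTransport` — RE-TIES `stub_finComponentTransport` (ED. 6)
import Summits.HodgeConjecture.HodgeConjecture.Theorems.K2E2AdmRepresentative               -- ★ socket #4 CLOSER (p854826): `admRepresentative` — RE-TIES `stub_admissibleRepresentative` (ED. 5)
import Summits.HodgeConjecture.HodgeConjecture.Theorems.F0P2qHdictEOfD1                   -- ★ `cSharpHol_of_D1`, `hdictEType_of_D1` (#113 ⟹ (C♯)hol ⟹ socket 27455)
import Literature.NumberTheory.Rogawski1990.CohomologicalSpectrumInnerForm                 -- E1′ BY NAME (`cohFinComponentUnique_hol`, junction OWNER P3 ∕ K2E1)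
import Literature.NumberTheory.Automorphic.Liu2021.CohHolMeetsThetaLiftFromLine            -- THE LETTER #113 `cohHol_meetsThetaLiftFromLine` (concluded BY NAME)
import Literature.NumberTheory.Automorphic.Liu2021.ThetaLiftFromLineCoinvariantJunction    -- ★ canonical finite frame transport `finPart ∘ cmAdelicFrameTransport ∘ finAdelicToAdelic`
import HarnessLib

-- statements over the theta-kernel datum elaborate to very large types; elaborate sequentially (as in the lineage)
set_option Elab.async false

/-!
ED. 9 (2026-09-04T03:52Z, dealer K2E2-plan (g2)): `stub_archPairHolCot` ★ FOLDED BY NAME (★ p857161 CLOSER `K2E2CapArchPairHolCot.capArchPairHolCot`); E2-own stubs ALL ★ (ADM, TR, OR, CAPR, R12, ARCH-ROWS-GEN, ARCH-PAIR-HOLCOT); sorries 4 = junction letters {PK, E3♭, E1′, E2′} only; heads unchanged.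

# K2 · ENGINE E2 «Weil representation ∕ theta» · LINE «THETA EXHAUSTION BY RIGIDITY»:
# the print letter #113 `Liu2021.cohHol_meetsThetaLiftFromLine` ⟸ {PK, E3♭, E1′} (junctions, all on K2E1's ledger) + three ★-assemblies

Cell hodgecm-mathlib (D-0151), Track B «K2-LIT», squad K2, seat K2E2-plan (g0); crux item H413 = stmt-HodgeConjecture-24833 (route of record
`HCCMUnconditional`; no route verbs).  Tier-0 workfile of CHAIR ORDER #1 (K2-lead g0) §1∕§4 (ED. 8 (dealer K2E2-plan (g2), 2026-09-04; merged with the (g0) candidate) = ED. 7 + R12 ★ FOLDED (p855353) onto ARCH-ROWS-GEN `StubArchRowsGen` (= `hA` of ★ p855353), itself ★ FOLDED (p855525 ∘ p855623, K2E2-p12) onto the NEW E2-own stub ARCH-PAIR-HOLCOT `StubArchPairHolCot` (= tier-1 socket #20a `Capture.sig_K2E2CapArchPairHolCot` = `hP` of ★ p855623 VERBATIM, ws-sha16 3efc5e019e17f8df; line lead K2E2-p12) — 5 sorries left: PK, E3♭, E1′, E2′ junctions + ARCH-PAIR-HOLCOT (the ONE open E2-own leaf: a holomorphic-cotangent Gaussian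 theta PAIR with a `U(W_a)(ℝ)`-fixed non-zero archimedean vector at a general real frame, [KonnoKonno2007, Thm. 5.4], [Liu2021, Lem. D.2 (2)]); ED. 7 = ED. 6 + ★ RE-TIE of OR (#18 p855379, K2E2-p03); ED. 6 = ED. 5 + TR re-tie + CAPR folded onto R12; ED. 5 = ED. 4 + ★ RE-TIE of ADM (#4 p854826); ED. 4 = R8 RE-CUT: `StubThetaClassCapture` WITHDRAWN (unsound at negative orientation `ι ∉ Φ_μ`), replaced by junction E2′ `hodgeTypeRigid` + E2-own `StubAntiholWitnessOfNeg` + `StubThetaClassCaptureR` (+ `ι ∈ hμ.cmType.1`) — 8 stubs (4 junction, 4 own); ED. 3 = ED. 2 + §6 HEAD A `cSharpHol_of_PK_E3flat` ∕ `hdictE_of_PK_E3flat`: (C♯)hol and the floor item `F0HdictE` from PK + E3♭ + ADM + TR only; ED. 2 = ED. 1 + §5 corollary per CHAIR RULING R1 (c1); stub statement bytes unchanged since ED. 1; tier-1 sockets in `K2_E2_ThetaExhaustionByRigidity_{AdmRep,ClassTransport,L2Completeness,Capture,Junctions}.lean`, table `…_Sigs.md`): `≤ 7` registered `stub_*` +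 the SORRY-FREE composition
`cohHol_meetsThetaLiftFromLine_of_line` concluding the letter BY NAME; companion card `K2_E2_ThetaExhaustionByRigidity.md`.
HONEST LABEL: HC_CM is proved only modulo the 7 printed citations (2 remaining named inputs: hLiu418 = stmt-HodgeConjecture-24832,
h413 = stmt-HodgeConjecture-24833) until rung 0 closes.  This file closes NO print letter; it re-routes one.

## The letter and its two sites
#113 `Literature.NumberTheory.Automorphic.Liu2021.cohHol_meetsThetaLiftFromLine` ([Liu2021, Prop. 4.13 proof Case 1, l. 2129–2136; Thm. B.4; Cor. B.6 (1)];
[GelbartRogawski1991, Thm. 5.1.1]): every HOLOMORPHIC-cotangent discrete `P` of the CM unitary group `U(H)` (signature `(2,1)` at `ι`, definite at the other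
places, `[L⁺:ℚ] ≥ 2`) MEETS the global theta lift from some hermitian line `⟨a⟩` at some conjugate-symplectic `μ`.  Open sites: `Lines/F0_P2E3Rung3.lean ::
stub_D1_letter`, `Lines/F0_P2CSharpHolThetaLine.lean :: stub_D1_thetaExhaustion` (two-site rule s737).  By ★ `F0P2qHdictEOfD1` it gives (C♯)hol, the socket
`F0HdictE` (27455) and — with the P3 row `F0HJ3a` — the crux `H413` (★ `F0P2mHdictEOfCSharpHol.H413_of_cSharpHol`).

## Why this line (E2 audit, K2E2-plan g0, 2026-09-03)
The printed proofs of theta EXHAUSTION are analytic: [GelbartRogawski1991, §4–§5] (Shimura-type integral along the Fourier–Jacobi coefficients of the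
unipotent radical — needs QUASI-SPLIT `U(2,1)`, p. 449; our `U(H)` is anisotropic over `L⁺`, `F`-rank `0`: NO Fourier–Jacobi expansion) and [Liu2021, App. B]
(doubling method: poles of `L(s, P × μ)` ⟸ [BMM16, 13.4], Siegel–Weil in Ichino's range [Thm. B.4 = GJS09], Rallis inner product [Cor. B.6 = Wu13] — in the
tree only the dictionary carpet `AppendixB/PolesEisensteinThetaLifting.lean`, no Eisenstein ∕ `L`-function carriers: XXL).  The E2 LOCAL content of the
engine (local theta dichotomy [GR91, Lem. 5.1.2] split∕non-split, [MVW87] rank one, [HKS96, Thm. 6.1] `n = 1`, the label and supercuspidality facts) is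
ALREADY ★ (books #96–#98, #104, #105, #110 closed).  What is left of #113 is GLOBAL, and the cell owns a trace-formula-free way to it that print only
sketches ([GelbartRogawski1991, Remark after Thm. 5.1.1, p. 466: «(c) ⇒ (a)» from Lemma 5.1.2 + the discreteness criterion + multiplicity one
[Rogawski1990, 13.3.1]]): RIGIDITY.  Given a hol-cotangent `P`:
1. PK (Rogawski's classification read per place, junction K2E1) ⟹ CE ⟹ (C♭) (★ `F0P2cSocketC.cohFinComponentIsThetaAdm_of_CE`): `P_f ↪ ω_H(μ, a, χ)`
   (`rhoAtLine …[e₁] ιV a χ`) for a weight-one conjugate-symplectic `μ`, a line `a ∈ (L⁺)ˣ`, a character `χ`;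
2. E3♭ (Rogawski 1992 Thm. 1.1 in automorphic currency, junction K2E1 via the ★ REL road ∕ REL♯¹) ⟹ the parity that makes the class collection of `a`
   `μ`-ADMISSIBLE; Hilbert reciprocity + Hasse-with-signs (★ `QuadraticForms.exists_prescribed_normClass_sign_iff_even`, ★ `isAdmissible_epsOf_iff_even`
   family) give an admissible representative `a′`, `locF a′ = locF a` (`stub_admissibleRepresentative`); `ω_H(μ,a,χ) ≃ ω_H(μ,a′,χ)` (★ `lineClassTransport_equiv`)
   transports the finite component (`stub_finComponentTransport`);
3. the theta series of `χ` from the ADMISSIBLE line `⟨a′⟩` is a non-zero HOLOMORPHIC cotangent `L²`-class (★ Θ-OCC-GEN `F0P2tThetaOccursInGenNeg.thetaOccursInGen`,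
   books #173 closed); every discrete constituent `P′` receiving a non-zero projection of it is hol-cotangent (★ letter-fold `holCotFormSpectralProjection_holds`)
   with finite component `ω_H(μ,a′,χ)` (★ node B′ `F0P2sNodeBPrimeHolds`); E1′ (`Rogawski1990.cohFinComponentUnique_hol`, junction P3∕K2E1 — ALREADY in the
   `F0HJ3a` cone: ★ `F0P3HJ3aOfThreeLettersF2`) forces `P′ = P`; discrete decomposability of `L²([U(H)])` (compact quotient, ★) then puts the theta class IN `P`
   (`stub_thetaClassCapture`) — `MeetsThetaLiftFromLine`.
No doubling, no Rallis inner product formula, no Howe-duality irreducibility of the global theta span, no new print letter: #113 leaves E2's books and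
lands on {PK, E3♭, E1′} — letters K2E1∕P3 build anyway — plus three M∕L ★-assemblies.  (For E3♭ itself the REL road `Lines/F0_P2E3RelSign.lean` ED. 4 is
strictly shorter; this line CONSUMES E3♭, so it is not a road to E3♭ — recorded deviation from CHAIR ORDER #1 §1, K2/STATUS 2026-09-03T20:18:57Z.)

## References (cite-tags audited against held pages — see the card's AUDIT lines)
* [Liu2021] Y. Liu, *Fourier–Jacobi cycles and arithmetic relative trace formula*, Camb. J. Math. 9 (2021) = arXiv:2102.11518: Def. 4.11–4.12, Prop. 4.13
  (proof l. 2121–2146), Rem. 4.14; App. B Thm. B.4, Cor. B.5, Cor. B.6; App. D Lem. D.1, D.2.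
* [GelbartRogawski1991] S. Gelbart, J. Rogawski, *L-functions and Fourier–Jacobi coefficients for the unitary group U(3)*, Invent. Math. 105 (1991):
  p. 449 (quasi-split scope), §3 (3.3)–(3.5), Thm. 5.1.1 p. 465, Lem. 5.1.2 and Remark p. 466.
* [Rogawski1990] J. Rogawski, Ann. of Math. Stud. 123: §12.3, Thm. 13.3.1, Thm. 13.3.6 (c), §14.6 Thm. 14.6.4, §15.3.
* [Rogawski1992] J. Rogawski, *The multiplicity formula for A-packets*, in: Zeta functions of Picard modular surfaces (CRM 1992): Thm. 1.1 p. 396, Thm. 1.2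
  p. 397, §2 (2.1) p. 399, weak multiplicity formula p. 417.
* [HarrisKudlaSweet1996] M. Harris, S. Kudla, W. J. Sweet, J. AMS 9 (1996): Thm. 6.1 p. 967.  [MoeglinVignerasWaldspurger1987] LNM 1291, Chap. 3.
* [Omeara1963] §71 Thm. 71:18–71:19.  [BorelJacquet1979] §4.6.  [GelfandGraevPiatetskiShapiro1969] Ch. 1 §2.3.  [Dixmier1977] §5.4.
-/

set_option autoImplicit false
-- the mandated namespace has the single-problem summit's repeated segment (`HodgeConjecture.HodgeConjecture`)
set_option linter.dupNamespace false

noncomputable section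

namespace Summit.HodgeConjecture.HodgeConjecture.Cruxes.H413.K2E2ThetaExhaustionByRigidity

open scoped TensorProduct Matrix ComplexOrder
open NumberField NumberField.InfinitePlace IsDedekindDomain MeasureTheory
open Literature.NumberTheory Literature.NumberTheory.Automorphic Literature.NumberTheory.Automorphic.UnitaryGroup
open Literature.NumberTheory.Automorphic.UnitaryGroup.CotangentForms
open Literature.NumberTheory.Automorphic.Liu2021
open Literature.NumberTheory.Automorphic.Liu2021.Def411WeilCarriers
open Literature.NumberTheory.Automorphic.Liu2021.Def411WeilCarriersDoubling
open Literature.NumberTheory.Automorphic.IdeleClassGroup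
open Literature.NumberTheory.GelbartRogawski1991 Literature.NumberTheory.GelbartRogawski1991.UnitaryDualPair
open Literature.NumberTheory.GelbartRogawski1991.UnitaryDualPair.WeilCoinv
open Literature.RepresentationTheory Literature.RepresentationTheory.Liu2021
open Literature.NumberTheory.Rogawski1990
open Literature.AlgebraicGeometry.Liu2021 (IsAdmissibleElement)
open Summit.HodgeConjecture.CorCM
open Summit.HodgeConjecture.CorCM.Transposition
open Summit.HodgeConjecture.HodgeConjecture.Cruxes.H413

/-! ## §1 The junction stubs (other engines' letters, stated BY NAME — bytes frozen) -/

/-- **stub PK (JUNCTION, OWNER: K2E1 — `F0P2CELocalToGlobal.StubPKLocalThetaClasses` ⇐ PKΠ ⇐ {S2♭ #80, O2♮} on E1's ledger).**  At every finite place the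
local component of a cotangent-type finite component `σ` of a discrete `P` of `U(H)` is Liu's local theta type `X_v(μ, ε_v, χ)[e₁]` for local classes
`ε_v`, cofinitely the unit class ([Rogawski1990, Thm. 13.3.6 (c), §13.3] + the local packet dictionary [GelbartRogawski1991, Lem. 5.1.2] ∕ [HarrisKudlaSweet1996,
Thm. 6.1]).  Stated BY NAME (tree `Lines/F0_P2CELocalToGlobal.lean` v1.1 :221, the only `sorry` there :456).  Why it might fail: only with PKΠ (E1).
[cite: Rogawski1990, Thm. 13.3.6 (c); §13.3] [cite: GelbartRogawski1991, Lem. 5.1.2 p. 466] [cite: HarrisKudlaSweet1996, Thm. 6.1 p. 967] -/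
theorem stub_PK : F0P2CELocalToGlobal.StubPKLocalThetaClasses := by
  sorry

/-- **stub E3♭ (JUNCTION, OWNER: K2E1 — `F0P2E3ParityRecut.StubE3FlatAutomorphicParity` ⇐ REL¹ ⇐ REL♯¹ (Rogawski's weak multiplicity formula, relative
parity) on the ★ REL road `Lines/F0_P2E3RelSign.lean` ED. 4; equivalently ⇐ E3♭∞ `stub_E3flatInf` over ★ HR-a).**  «Occurrence ⇒ parity»: if `ω_H(μ, a, χ)` is
the finite component of a cotangent discrete `P`, then `#{v : [a]_v ≠ 1} + #{φ ∈ Φ_μ : Im φ((2δ)⁻¹) > 0}` is even ([Rogawski1992, Thm. 1.1]: `π(w) ∈ Π(ρ)` is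
automorphic iff `#{v : ε_v = −1}` is even; [Liu2021, Rem. 4.14]).  Stated BY NAME (tree :137).  Why it might fail: only with REL♯¹ ∕ E3♭∞ (E1).
[cite: Rogawski1992, Thm. 1.1 p. 396; §2 (2.1) p. 399] [cite: Liu2021, Rem. 4.14; Def. 4.12] [cite: Rogawski1990, Thm. 14.6.4] -/
theorem stub_E3flat : F0P2E3ParityRecut.StubE3FlatAutomorphicParity := by
  sorry

/-- **stub E1′ (JUNCTION, OWNER: P3 ∕ K2E1 — `Rogawski1990.cohFinComponentUnique_hol` ⇐ E1 `innerFormMultiplicityLeOne` + F1a ★ + F1b + B1′ value maps,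
★ fold `F0P3CohFinComponentUniqueOfE1.cohFinComponentUnique_hol_of_valueMaps`; ALREADY a hypothesis of the `F0HJ3a` row: ★ `F0P3HJ3aOfThreeLettersF2`).**
Two holomorphic-cotangent discrete `P`, `P′` of `U(H)` sharing an irreducible smooth finite component are EQUAL ([Rogawski1990, Thm. 14.6.4 (multiplicity one
for the inner forms); §12.3; Prop. 15.2.1 (b)]).  Stated BY NAME.  Why it might fail: only with E1 (the stable trace formula for `U(3)` and its inner forms).
[cite: Rogawski1990, §14.6 Thm. 14.6.4; §12.3 p. 174; Prop. 15.2.1 (b); §15.3] [cite: Dixmier1977, §5.4] -/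
theorem stub_E1prime : Literature.NumberTheory.Rogawski1990.cohFinComponentUnique_hol := by
  sorry

/-- **stub E2′ (JUNCTION, OWNER: P3 ∕ K2E1 — `Rogawski1990.hodgeTypeRigid`, SIGN-FREE Hodge-type rigidity; ALREADY a hypothesis of the `F0HJ3a` row next to E1′).**
No irreducible smooth `σ` is the finite component of BOTH a holomorphic-cotangent and an antiholomorphic-cotangent discrete `P` of `U(H)` ([Rogawski1990,
Thm. 13.3.6 (c); §12.3 p. 174; Thm. 14.6.4 proof l. 1; Thm. 13.3.5]: both lie in `Π′(ξ)`, `Π′(ξ′)` with `dim ξ = dim ξ′ = 1`, `ξ_ι ≠ ξ′_ι`, but `ξ` is determined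
by the e.v.p. of `P_f ≅ σ ≅ P′_f`).  Stated BY NAME; used ONCE, to exclude the negative orientation `ι ∉ Φ_μ` in HEAD B (with `StubAntiholWitnessOfNeg`).
Why it might fail: only with E1-type input (Rogawski's classification for the inner forms). [cite: Rogawski1990, Thm. 13.3.6 (c); §15.3 ¶1; §12.3 p. 174; Thm. 14.6.4; Thm. 13.3.5]
[cite: Marshall2014, §3.3] [cite: BorelWallach2000, VII 3.2 and 3.6] -/
theorem stub_E2prime : Literature.NumberTheory.Rogawski1990.hodgeTypeRigid := by
  sorry

/-! ## §2 The three E2-own stubs (★-assemblies; NO print letter inside) -/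

/-- **stub ADM (E2-own, size M) — THE ADMISSIBLE REPRESENTATIVE OF A PARITY-EVEN LINE.**  For a conjugate-symplectic `μ` (CM type `Φ_μ = hμ.cmType`) and a
line `a ∈ (L⁺)ˣ` whose E3♭-count `#{v : [a]_v ≠ 1 in L⁺_vˣ⧸N(L_vˣ)} + #{φ ∈ Φ_μ : Im φ((2δ)⁻¹) > 0}` is EVEN (`δ = imagUnit L`), there is `a′ ∈ (L⁺)ˣ` with
the SAME finite class collection (`locF a′ = locF a`) such that `a′ · (2δ)⁻¹` is `Φ_μ`-admissible ([Liu2021, Def. 4.12]: `Im φ(a′(2δ)⁻¹) < 0` for all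
`φ ∈ Φ_μ`).  PROOF PLAN: the set `T` of real places where the sign of `a` is wrong has `#T ≡ #{Im > 0} + #{φ ∈ Φ_μ : φ(a) < 0}`; Hilbert reciprocity for
`(a, imagUnitSq L)` (★ HR-a `even_ncard_locF_ne_one_add_card_neg`, [Omeara1963, 71:18]) and the hypothesis make `#T` even; ★
`QuadraticForms.exists_prescribed_normClass_sign_iff_even` ([Omeara1963, 71:19]) gives `θ ∈ (L⁺)ˣ`, a local norm at every finite place, negative exactly on
`T`; `a′ := a·θ` (★ `isAdmissible_epsOf_iff_even` ∕ `AdmissibleLine` bookkeeping, `IsAdmissibleElement.mem_iff_im_pos`).  Why it might fail: only a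
sign-convention slip (`< 0` vs `> 0` in `IsAdmissibleElement`) — guarded: (C♯)hol ★ `cSharpHol_of_D1` and ★ `e3flatArch_of_cohFinComponent_isThetaSigned` use
these exact conventions together.
[cite: Liu2021, Def. 4.12 (l. 2102–2108); Rem. 4.14] [cite: Omeara1963, §71 Thm. 71:18, Thm. 71:19, Cor. 71:19a] [cite: Rogawski1992, Thm. 1.1] -/
def StubAdmissibleRepresentative : Prop :=
  ∀ (L : Type) [Field L] [NumberField L] [IsCMField L]
    (μ : Literature.NumberTheory.Automorphic.IdeleClassGroup L →ₜ* Circle) (hμ : IsConjugateSymplectic L μ)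
    (a : (↥(maximalRealSubfield L))ˣ),
    Even ({v : HeightOneSpectrum (𝓞 ↥(maximalRealSubfield L)) |
            locF (↥(maximalRealSubfield L)) (imagUnitSq L) a v ≠ 1}.ncard +
      {φ : L →+* ℂ | φ ∈ hμ.cmType.1 ∧ 0 < (φ (2 * imagUnit L)⁻¹).im}.ncard) →
    ∃ a' : (↥(maximalRealSubfield L))ˣ,
      locF (↥(maximalRealSubfield L)) (imagUnitSq L) a' = locF (↥(maximalRealSubfield L)) (imagUnitSq L) a ∧
      IsAdmissibleElement L hμ.cmType.1 (algebraMap (↥(maximalRealSubfield L)) L a' * (2 * imagUnit L)⁻¹)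

/-- stub admissibleRepresentative — `sorry` = open (E2-own ★-assembly; see the `def` docstring above for statement, plan, sources). -/
theorem stub_admissibleRepresentative : StubAdmissibleRepresentative :=
  K2E2AdmRepresentative.admRepresentative  -- ★ RE-TIED (ED. 5): socket #4 p854826, unit ADM-REP ★ 4∕4 (#1 p854834 · #2 p854814 · #3 p854804 · #4 p854826)

set_option synthInstance.maxHeartbeats 400000 in
set_option maxHeartbeats 8000000 in
/-- **stub TR (E2-own, size M) — FINITE-COMPONENT TRANSPORT TO A LINE WITH THE SAME CLASSES.**  In the (C♭) frame: if the irreducible `σ` is a finite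
component of the discrete `P` and embeds into Liu's carrier `ω_H(μ, a, χ) = rhoAtLine …[e₁] ιV a χ` (the (C♭) output), and `locF a′ = locF a`, then
`ω_H(μ, a′, χ)` is a finite component of `P`.  PROOF PLAN: `ω_H(μ,a,χ)` is irreducible (★ `F0P2cStubCI.rhoAtLine_chi_isIrreducible`), so the injective
intertwiner `σ ↪ ω_H` is an isomorphism (Schur-free: image a non-zero subrepresentation); `ω(μ, ε, χ)` depends on the line only through its collection
`ε = locF a` — ★ `lineClassTransport_equiv` (`F0P2sThetaOccursInLineTransport`; [Liu2021, Def. 4.11–4.12]; [GelbartRogawski1991, §3.1 Prop. 3.1.1, Remark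
p. 457]; [MVW87, Chap. 3 I.1–I.3]) — and `HasFinComponent` passes along equivariant equivalences (★ `hasFinComponent_of_equiv` pattern).  Why it might fail:
only if `HasFinComponent` were not invariant under isomorphism of `σ` (it is: an injective equivariant map composed with an equivalence).
[cite: Liu2021, Def. 4.11 (l. 2092–2096); Def. 4.12; App. D Lem. D.1 (1)] [cite: GelbartRogawski1991, §3.1 Prop. 3.1.1 p. 455] [cite: FlathCorvallis1979, Thm. 3] -/
def StubFinComponentTransport : Prop :=
  ∀ (L : Type) [Field L] [NumberField L] [IsCMField L] (ι : L →+* ℂ) (H : Matrix (Fin 3) (Fin 3) L) (T : GL (Fin 3) ℂ)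
    (hT : (T : Matrix (Fin 3) (Fin 3) ℂ)ᴴ * H.map ι * (T : Matrix (Fin 3) (Fin 3) ℂ) = Literature.Geometry.ComplexHyperbolic.BallModel.J),
    (∀ τ' : L →+* ℂ, InfinitePlace.mk τ' ≠ InfinitePlace.mk ι → (H.map τ').PosDef) → 2 ≤ Module.finrank ℚ ↥(maximalRealSubfield L) →
    ∀ {n' : ℕ} (e₁ : Fin 3 × Fin 1 ≃ Fin n') (dV : Fin 3 → L) (hdV : ∀ i, IsCMField.complexConj L (dV i) = dV i)
      (hdV0 : ∀ i, dV i ≠ 0) (g : GL (Fin 3) L)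
      (hg : ((g : Matrix (Fin 3) (Fin 3) L).map (cmConjRingHom L))ᵀ * H * (g : Matrix (Fin 3) (Fin 3) L) = Matrix.diagonal dV)
      (ιV : finAdelic (↥(maximalRealSubfield L)) L (IsCMField.complexConj L) 3 H →*
          finAdelic (↥(maximalRealSubfield L)) L (IsCMField.complexConj L) 3 (Matrix.diagonal dV)),
        (∀ k, ((ιV k : finAdelic (↥(maximalRealSubfield L)) L (IsCMField.complexConj L) 3 (Matrix.diagonal dV)) :
            GL (Fin 3) (FiniteAdeleRing (𝓞 L) L)) =
          (toFinAdeleGL L 3 g)⁻¹ * (k : GL (Fin 3) (FiniteAdeleRing (𝓞 L) L)) * toFinAdeleGL L 3 g) →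
        ∀ (μA : Measure (adelicGroupData (↥(maximalRealSubfield L)) L (IsCMField.complexConj L) 3 H).automorphicQuotient)
          [(adelicGroupData (↥(maximalRealSubfield L)) L (IsCMField.complexConj L) 3 H).IsAutomorphicMeasure μA]
          (W : Type) [AddCommGroup W] [Module ℂ W]
          (σ : Representation ℂ (finAdelic (↥(maximalRealSubfield L)) L (IsCMField.complexConj L) 3 H) W),
          σ.IsIrreducible →
        ∀ (P : DiscreteAutomorphicRep (adelicGroupData (↥(maximalRealSubfield L)) L (IsCMField.complexConj L) 3 H) μA)
          (μ : Literature.NumberTheory.Automorphic.IdeleClassGroup L →ₜ* Circle) (hμ : IsConjugateSymplectic L μ)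
          (a a' : (↥(maximalRealSubfield L))ˣ) (χ : Chi (↥(maximalRealSubfield L)) L (IsCMField.complexConj L)),
          P.HasFinComponent σ →
          (∃ f : σ.IntertwiningMap
              (rhoAtLine (↥(maximalRealSubfield L)) L (IsCMField.complexConj L) 3 e₁ (Matrix.diagonal dV)
                (complexConj_imagUnit L) (imagUnit_ne_zero L) (imagUnit_mul_self L) (realDiagonal_isSymm L dV hdV)
                (isUnit_det_realDiagonal L dV hdV hdV0) (realDiagonal_map L dV hdV).symm
                (fun a => isCompatible_chiSplittingLine L e₁ dV hdV hdV0 (toHeckeCharacter L μ)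
                  (isUnitary_toHeckeCharacter L μ) ((isOscillatorChar_toHeckeCharacter_iff μ).mpr hμ)
                  (TW (↥(maximalRealSubfield L)) a) (isSymm_TW (↥(maximalRealSubfield L)) a)
                  (isUnit_det_TW (↥(maximalRealSubfield L)) a) (JW (↥(maximalRealSubfield L)) L a)
                  (JW_eq (↥(maximalRealSubfield L)) L a)) ιV a χ),
            Function.Injective f) →
          locF (↥(maximalRealSubfield L)) (imagUnitSq L) a' = locF (↥(maximalRealSubfield L)) (imagUnitSq L) a →
          P.HasFinComponent
            (rhoAtLine (↥(maximalRealSubfield L)) L (IsCMField.complexConj L) 3 e₁ (Matrix.diagonal dV)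
              (complexConj_imagUnit L) (imagUnit_ne_zero L) (imagUnit_mul_self L) (realDiagonal_isSymm L dV hdV)
              (isUnit_det_realDiagonal L dV hdV hdV0) (realDiagonal_map L dV hdV).symm
              (fun a => isCompatible_chiSplittingLine L e₁ dV hdV hdV0 (toHeckeCharacter L μ)
                (isUnitary_toHeckeCharacter L μ) ((isOscillatorChar_toHeckeCharacter_iff μ).mpr hμ)
                (TW (↥(maximalRealSubfield L)) a) (isSymm_TW (↥(maximalRealSubfield L)) a)
                (isUnit_det_TW (↥(maximalRealSubfield L)) a) (JW (↥(maximalRealSubfield L)) L a)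
                (JW_eq (↥(maximalRealSubfield L)) L a)) ιV a' χ)

/-- stub finComponentTransport — `sorry` = open (E2-own ★-assembly; see the `def` docstring above for statement, plan, sources). -/
theorem stub_finComponentTransport : StubFinComponentTransport :=
  K2E2TrFinComponentTransport.finComponentTransport  -- ★ RE-TIED (ED. 6): socket #8 p854824, unit CLASS-TRANSPORT ★ 4∕4 (#5 p854800 · #6 p854793 · #7 p854833 · #8 p854824)

set_option synthInstance.maxHeartbeats 400000 in
set_option maxHeartbeats 8000000 in
/-- **stub CAP (E2-own, size L) — THETA-CLASS CAPTURE UNDER RIGIDITY.**  In the frame of #113 (adelic transport `ιA` pinned by `g`) and of (C♯)hol (finite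
transport `ιV` pinned by `g`): let `P` be hol-cotangent with finite component `ω_H(μ, a, χ)`, `μ` of weight one, the element `a·(2δ)⁻¹` `Φ_μ`-ADMISSIBLE, and
suppose RIGIDITY — every hol-cotangent discrete `P′` (same measure) with finite component `ω_H(μ, a, χ)` equals `P`.  Then `P` MEETS the theta lift from
`⟨a⟩` at the `μ`-splitting along `ιA`.  PROOF PLAN: (i) the theta series of the character `χ̃_χ` of `[U(⟨a⟩)]` lifted with a Gaussian of holomorphic type is a
NON-ZERO `L²`-class `θ = [Θ̃_Φ(charCM χ̃_χ) ∘ ιA]`, the class of a HOLOMORPHIC cotangent form — ★ Θ-OCC-GEN `F0P2tThetaOccursInGenNeg.thetaOccursInGen` (books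
#173, general frame; admissibility decides the sign at `ι` and at the compact places: [Liu2021, Lem. D.2 (2)], ★ C∞∕Cc); (ii) for every discrete `P′` with
`pr_{P′} θ ≠ 0`: `P′` is hol-cotangent (★ letter-fold `F0P2dSocketD.holCotFormSpectralProjection_holds`, [BorelWallach2000, VI; XIII 1.2]) and
`P′.HasFinComponent ω_H(μ,a,χ)` (★ node B′ `F0P2sNodeBPrimeHolds.hasFinComponent_rhoAtLine_three_of_starProjection_ne_zero_of_coe`, [Liu2021, l. 2136–2137;
Lem. D.1]); hence `P′ = P` by RIGIDITY; (iii) `L²([U(H)], μA)` is discretely decomposable (compact quotient ★ `compactSpace_automorphicQuotient_cm`, ★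
`isDiscretelyDecomposable_rightRegular_…`; ★ `F0P3IrreducibleConstituentOfUnitary` inside `Pᗮ`): if `θ ∉ P` some irreducible `Q ≤ Pᗮ` has `pr_Q θ ≠ 0`,
contradicting (ii); so `θ ∈ P`, which is `MeetsThetaLiftFromLine` ([Liu2021, proof of Prop. 4.13 Case 1 «In other words…»]; the rank-generic pattern is ★
`F0LD2MeetsOfNonOrthogonal` for the CM curves).  Why it might fail: the Θ-OCC-GEN class is typed at the ADELIC frame of its own choosing — a transport of its
`∃ θ`-clause to the pinned `ιA` of #113 is needed (★ `cmAdelicFrameTransport` uniqueness of pinned transports); no mathematical risk known.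
[cite: Liu2021, Prop. 4.13 proof Case 1 (l. 2129–2137); Def. 4.12; App. D Lem. D.1, Lem. D.2 (2)] [cite: Rallis1984, Thm. 1.2.2 proof p. 356]
[cite: BorelJacquet1979, §4.6] [cite: GelfandGraevPiatetskiShapiro1969, Ch. 1 §2.3] [cite: BorelWallach2000, VI; XIII 1.2] [cite: Dixmier1977, §5.4] -/
def StubThetaClassCapture : Prop :=
  ∀ (L : Type) [Field L] [NumberField L] [IsCMField L] (ι : L →+* ℂ) (H : Matrix (Fin 3) (Fin 3) L) (T : GL (Fin 3) ℂ)
    (hT : (T : Matrix (Fin 3) (Fin 3) ℂ)ᴴ * H.map ι * (T : Matrix (Fin 3) (Fin 3) ℂ) = Literature.Geometry.ComplexHyperbolic.BallModel.J),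
    (∀ τ' : L →+* ℂ, InfinitePlace.mk τ' ≠ InfinitePlace.mk ι → (H.map τ').PosDef) → 2 ≤ Module.finrank ℚ ↥(maximalRealSubfield L) →
    ∀ {n' : ℕ} (e₁ : Fin 3 × Fin 1 ≃ Fin n') (dV : Fin 3 → L) (hdV : ∀ i, IsCMField.complexConj L (dV i) = dV i)
      (hdV0 : ∀ i, dV i ≠ 0) (g : GL (Fin 3) L)
      (hg : ((g : Matrix (Fin 3) (Fin 3) L).map (cmConjRingHom L))ᵀ * H * (g : Matrix (Fin 3) (Fin 3) L) = Matrix.diagonal dV)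
      (ιA : (adelicGroupData (↥(maximalRealSubfield L)) L (IsCMField.complexConj L) 3 H).Adelic →*
          ↥(UnitaryGroup.adelic (↥(maximalRealSubfield L)) L (IsCMField.complexConj L) 3 (Matrix.diagonal dV))),
        (∀ k, ((ιA k : ↥(UnitaryGroup.adelic (↥(maximalRealSubfield L)) L (IsCMField.complexConj L) 3 (Matrix.diagonal dV))) :
              GL (Fin 3) (AdeleRing (𝓞 L) L)) =
            (toAdeleGL L g)⁻¹ * adelicVal (↥(maximalRealSubfield L)) L (IsCMField.complexConj L) 3 H k * toAdeleGL L g) →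
      ∀ (ιV : finAdelic (↥(maximalRealSubfield L)) L (IsCMField.complexConj L) 3 H →*
          finAdelic (↥(maximalRealSubfield L)) L (IsCMField.complexConj L) 3 (Matrix.diagonal dV)),
        (∀ k, ((ιV k : finAdelic (↥(maximalRealSubfield L)) L (IsCMField.complexConj L) 3 (Matrix.diagonal dV)) :
            GL (Fin 3) (FiniteAdeleRing (𝓞 L) L)) =
          (toFinAdeleGL L 3 g)⁻¹ * (k : GL (Fin 3) (FiniteAdeleRing (𝓞 L) L)) * toFinAdeleGL L 3 g) →
      ∀ [CompactSpace (↥(UnitaryGroup.adelic (↥(maximalRealSubfield L)) L (IsCMField.complexConj L) 3 (Matrix.diagonal dV)) ⧸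
          (UnitaryGroup.toAdelic (↥(maximalRealSubfield L)) L (IsCMField.complexConj L) 3 (Matrix.diagonal dV)).range)],
      ∀ (μA : Measure (adelicGroupData (↥(maximalRealSubfield L)) L (IsCMField.complexConj L) 3 H).automorphicQuotient)
        [(adelicGroupData (↥(maximalRealSubfield L)) L (IsCMField.complexConj L) 3 H).IsAutomorphicMeasure μA]
        (P : DiscreteAutomorphicRep (adelicGroupData (↥(maximalRealSubfield L)) L (IsCMField.complexConj L) 3 H) μA),
        P.IsHolCotangentAt (cmArchSection L ι H T hT) (cmCompactFactor L ι H T hT) →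
        ∀ (μ : Literature.NumberTheory.Automorphic.IdeleClassGroup L →ₜ* Circle) (hμ : IsConjugateSymplectic L μ), HasWeight L μ 1 →
          ∀ (a : (↥(maximalRealSubfield L))ˣ) (χ : Chi (↥(maximalRealSubfield L)) L (IsCMField.complexConj L)),
            IsAdmissibleElement L hμ.cmType.1 (algebraMap (↥(maximalRealSubfield L)) L a * (2 * imagUnit L)⁻¹) →
            P.HasFinComponent
              (rhoAtLine (↥(maximalRealSubfield L)) L (IsCMField.complexConj L) 3 e₁ (Matrix.diagonal dV)
                (complexConj_imagUnit L) (imagUnit_ne_zero L) (imagUnit_mul_self L) (realDiagonal_isSymm L dV hdV)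
                (isUnit_det_realDiagonal L dV hdV hdV0) (realDiagonal_map L dV hdV).symm
                (fun a => isCompatible_chiSplittingLine L e₁ dV hdV hdV0 (toHeckeCharacter L μ)
                  (isUnitary_toHeckeCharacter L μ) ((isOscillatorChar_toHeckeCharacter_iff μ).mpr hμ)
                  (TW (↥(maximalRealSubfield L)) a) (isSymm_TW (↥(maximalRealSubfield L)) a)
                  (isUnit_det_TW (↥(maximalRealSubfield L)) a) (JW (↥(maximalRealSubfield L)) L a)
                  (JW_eq (↥(maximalRealSubfield L)) L a)) ιV a χ) →
            (∀ P' : DiscreteAutomorphicRep (adelicGroupData (↥(maximalRealSubfield L)) L (IsCMField.complexConj L) 3 H) μA,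
                P'.IsHolCotangentAt (cmArchSection L ι H T hT) (cmCompactFactor L ι H T hT) →
                P'.HasFinComponent
                  (rhoAtLine (↥(maximalRealSubfield L)) L (IsCMField.complexConj L) 3 e₁ (Matrix.diagonal dV)
                    (complexConj_imagUnit L) (imagUnit_ne_zero L) (imagUnit_mul_self L) (realDiagonal_isSymm L dV hdV)
                    (isUnit_det_realDiagonal L dV hdV hdV0) (realDiagonal_map L dV hdV).symm
                    (fun a => isCompatible_chiSplittingLine L e₁ dV hdV hdV0 (toHeckeCharacter L μ)
                      (isUnitary_toHeckeCharacter L μ) ((isOscillatorChar_toHeckeCharacter_iff μ).mpr hμ)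
                      (TW (↥(maximalRealSubfield L)) a) (isSymm_TW (↥(maximalRealSubfield L)) a)
                      (isUnit_det_TW (↥(maximalRealSubfield L)) a) (JW (↥(maximalRealSubfield L)) L a)
                      (JW_eq (↥(maximalRealSubfield L)) L a)) ιV a χ) →
                P' = P) →
            MeetsThetaLiftFromLine L 3 H e₁ dV hdV hdV0 P μ hμ a ιA

/-- **WITHDRAWN (ED. 4, 2026-09-03) — `StubThetaClassCapture` is UNSOUND at NEGATIVE ORIENTATION `ι ∉ Φ_μ`** (dealer's R8 self-flag, K2∕STATUS
2026-09-03T21:13:25Z): the holomorphic theta engine ★ `F0P2sThetaOccursInEngineGen.exists_holTheta_atFrame_of_chiN` needs `(hι : ι₁ ∈ hμ.cmType.1)`, and at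
`ι ∉ Φ_μ` the theta forms of Φ_μ-admissible data `(μ, ⟨a⟩, χ)` are the complex CONJUGATES of the conjugate partner's holomorphic forms (★ `F0P2tThetaOccursInGenNeg`,
`θ := conjFun ∘ θ′ ∘ J`; ★ `mem_cohForms_comp_of_conj`: hol ↦ conj hol), i.e. ANTIholomorphic at the frame `(ι, T)` — a holomorphic `P` is orthogonal to them.
Liu never meets this case ([Liu2021] fixes `Φ ∋ ι` and takes `μ` of weight one relative to `Φ`; our typing derives `Φ_μ` from `μ`).  The `def` above keeps its
bytes as the NEGATIVE EDGE (= withdrawn socket #13 `Capture.sig_K2E2CapThetaClassCapture`); its `stub_` theorem is removed; the line now runs through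
the junction letter E2′ `Rogawski1990.hodgeTypeRigid` (hol and antihol never share a finite component), the E2-own `StubAntiholWitnessOfNeg` (a negatively
oriented admissible label HAS an antiholomorphic carrier — so for the holomorphic `P` of #113 the case `ι ∉ Φ_μ` is contradictory) and `StubThetaClassCaptureR`
(= the old text + `ι ∈ hμ.cmType.1`).  A ℂ-linear «orientation swap» of the label of a FIXED `P` is FALSE in rank 3 ([Liu2021, Lem. D.1 (3)]: the label is
unique; K2E2-p06 2026-09-03T21:19:09Z) and was never written. -/
theorem StubThetaClassCapture_withdrawn : True := trivial

set_option synthInstance.maxHeartbeats 400000 in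
set_option maxHeartbeats 8000000 in
/-- **stub OR (E2-own, size M given socket #12R) — THE ANTIHOLOMORPHIC WITNESS OF A NEGATIVELY ORIENTED ADMISSIBLE LABEL** (K2E2-p06's R8 pre-write flag
2026-09-03T21:19:09Z, adopted).  TEL frame, pinned `ιA` ∕ `ιV`, `[U(diag dV)]` compact, automorphic `μA`: for `μ` conjugate-symplectic of weight one with
`ι ∉ Φ_μ` and `a·(2δ)⁻¹` `Φ_μ`-ADMISSIBLE, some ANTIholomorphic-cotangent discrete `P″` has finite component `ω_H(μ, a, χ)[ιV]`.  PLAN (the partner road of ★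
`F0P2tThetaOccursInGenNeg` Case B, read on receivers): the CONJUGATE PARTNER data `(μ′, −a, χ̄)` — `μ′` weight one with `HasCMType μ′ Φ̄_μ` (★
`H413MirrorAtPinLine.exists_weightOne_mirror_sChiD` ∕ `exists_conjPartner_omegaAtLine_neg`), so `ι ∈ Φ_(μ′)`, and `(−a)(2δ)⁻¹` `Φ̄`-admissible (★
`Literature.AlgebraicGeometry.Liu2021.isAdmissibleElement_conj_neg_iff`) — is POSITIVELY oriented: socket #12R gives a non-zero pinned theta class whose receivers
are hol-cotangent with finite component `ω_H(μ′,−a,χ̄)[ιV]`, and a receiver `P′` exists (`L²` discretely decomposable: ★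
`isDiscretelyDecomposable_rightRegular_adelicGroupData`); `P″ := P′.conj` is antihol-cotangent (★ `isHolCotangentAt_iff_conj`) with finite component
`repConj ω_H(μ′,−a,χ̄)[ιV]` (★ `hasFinComponent_conj_repConj`) `≅ ω_H(μ,a,χ)[ιV]` ℂ-LINEARLY (`toConj ∘ J`, ★ J conjugate-linear bijective equivariant:
`exists_conjPartner_omegaAtLine_neg`, in the generic currency = socket OR-1), moved by ★ `K2E2TrHasFinComponentOfBijective` (socket #6, p854793).
Why it might fail: ★ J is typed in the HodgeCM currency (`frameD V`, `hsChiD`) — a generic-currency twin (`dV`, `isCompatible_chiSplittingLine`) is the real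
cost (adapter ★ `cmFieldOf` ∕ `hermSpace3Of`); no mathematical risk known.  NOT a ℂ-linear relabelling of `P` itself: for rank 3 the label is UNIQUE
([Liu2021, Lem. D.1 (3)]; the companion `μᶜ·χ̌` of Lem. D.1 (4) is the rank-2 phenomenon), so an «orientation swap» of a fixed `P` is FALSE — dead end recorded.
[cite: Liu2021, App. D Lem. D.1 (2)–(3) (l. 5231–5233); Rem. 4.4; proof of Prop. 4.13 Case 1 (l. 2129–2137)] [cite: GelbartRogawski1991, §3.1 Prop. 3.1.1 p. 455; Remark p. 457]
[cite: BorelJacquet1979, §4.6] [cite: BorelWallach2000, VII 2.10, 3.2] [cite: Clozel1990, §3.1] -/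
def StubAntiholWitnessOfNeg : Prop :=
  ∀ (L : Type) [Field L] [NumberField L] [IsCMField L] (ι : L →+* ℂ) (H : Matrix (Fin 3) (Fin 3) L) (T : GL (Fin 3) ℂ)
    (hT : (T : Matrix (Fin 3) (Fin 3) ℂ)ᴴ * H.map ι * (T : Matrix (Fin 3) (Fin 3) ℂ) = Literature.Geometry.ComplexHyperbolic.BallModel.J),
    (∀ τ' : L →+* ℂ, InfinitePlace.mk τ' ≠ InfinitePlace.mk ι → (H.map τ').PosDef) → 2 ≤ Module.finrank ℚ ↥(maximalRealSubfield L) →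
    ∀ {n' : ℕ} (e₁ : Fin 3 × Fin 1 ≃ Fin n') (dV : Fin 3 → L) (hdV : ∀ i, IsCMField.complexConj L (dV i) = dV i)
      (hdV0 : ∀ i, dV i ≠ 0) (g : GL (Fin 3) L)
      (hg : ((g : Matrix (Fin 3) (Fin 3) L).map (cmConjRingHom L))ᵀ * H * (g : Matrix (Fin 3) (Fin 3) L) = Matrix.diagonal dV)
      (ιA : (adelicGroupData (↥(maximalRealSubfield L)) L (IsCMField.complexConj L) 3 H).Adelic →*
          ↥(UnitaryGroup.adelic (↥(maximalRealSubfield L)) L (IsCMField.complexConj L) 3 (Matrix.diagonal dV))),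
        (∀ k, ((ιA k : ↥(UnitaryGroup.adelic (↥(maximalRealSubfield L)) L (IsCMField.complexConj L) 3 (Matrix.diagonal dV))) :
              GL (Fin 3) (AdeleRing (𝓞 L) L)) =
            (toAdeleGL L g)⁻¹ * adelicVal (↥(maximalRealSubfield L)) L (IsCMField.complexConj L) 3 H k * toAdeleGL L g) →
      ∀ (ιV : finAdelic (↥(maximalRealSubfield L)) L (IsCMField.complexConj L) 3 H →*
          finAdelic (↥(maximalRealSubfield L)) L (IsCMField.complexConj L) 3 (Matrix.diagonal dV)),
        (∀ k, ((ιV k : finAdelic (↥(maximalRealSubfield L)) L (IsCMField.complexConj L) 3 (Matrix.diagonal dV)) :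
            GL (Fin 3) (FiniteAdeleRing (𝓞 L) L)) =
          (toFinAdeleGL L 3 g)⁻¹ * (k : GL (Fin 3) (FiniteAdeleRing (𝓞 L) L)) * toFinAdeleGL L 3 g) →
      ∀ [CompactSpace (↥(UnitaryGroup.adelic (↥(maximalRealSubfield L)) L (IsCMField.complexConj L) 3 (Matrix.diagonal dV)) ⧸
          (UnitaryGroup.toAdelic (↥(maximalRealSubfield L)) L (IsCMField.complexConj L) 3 (Matrix.diagonal dV)).range)],
      ∀ (μA : Measure (adelicGroupData (↥(maximalRealSubfield L)) L (IsCMField.complexConj L) 3 H).automorphicQuotient)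
        [(adelicGroupData (↥(maximalRealSubfield L)) L (IsCMField.complexConj L) 3 H).IsAutomorphicMeasure μA]
        (μ : Literature.NumberTheory.Automorphic.IdeleClassGroup L →ₜ* Circle) (hμ : IsConjugateSymplectic L μ), HasWeight L μ 1 →
          ι ∉ hμ.cmType.1 →
          ∀ (a : (↥(maximalRealSubfield L))ˣ) (χ : Chi (↥(maximalRealSubfield L)) L (IsCMField.complexConj L)),
            IsAdmissibleElement L hμ.cmType.1 (algebraMap (↥(maximalRealSubfield L)) L a * (2 * imagUnit L)⁻¹) →
            ∃ P'' : DiscreteAutomorphicRep (adelicGroupData (↥(maximalRealSubfield L)) L (IsCMField.complexConj L) 3 H) μA,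
              P''.IsAntiholCotangentAt (cmArchSection L ι H T hT) (cmCompactFactor L ι H T hT) ∧
              P''.HasFinComponent
                (rhoAtLine (↥(maximalRealSubfield L)) L (IsCMField.complexConj L) 3 e₁ (Matrix.diagonal dV)
                (complexConj_imagUnit L) (imagUnit_ne_zero L) (imagUnit_mul_self L) (realDiagonal_isSymm L dV hdV)
                (isUnit_det_realDiagonal L dV hdV hdV0) (realDiagonal_map L dV hdV).symm
                (fun a => isCompatible_chiSplittingLine L e₁ dV hdV hdV0 (toHeckeCharacter L μ)
                  (isUnitary_toHeckeCharacter L μ) ((isOscillatorChar_toHeckeCharacter_iff μ).mpr hμ)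
                  (TW (↥(maximalRealSubfield L)) a) (isSymm_TW (↥(maximalRealSubfield L)) a)
                  (isUnit_det_TW (↥(maximalRealSubfield L)) a) (JW (↥(maximalRealSubfield L)) L a)
                  (JW_eq (↥(maximalRealSubfield L)) L a)) ιV a χ)

/-- stub antiholWitnessOfNeg — `sorry` = open (E2-own ★-assembly; see the `def` docstring above for statement, plan, sources). -/
theorem stub_antiholWitnessOfNeg : StubAntiholWitnessOfNeg :=
  @Summit.HodgeConjecture.HodgeConjecture.Cruxes.H413.K2E2OrAntiholWitnessOfNeg.orAntiholWitnessOfNeg  -- ★ RE-TIED (ED. 7): socket #18 p855379 (K2E2-p03; road: ★ GenNeg Cases B∕C antihol + ★ antihol spectral projection + ★ B′, waves p855085 p855090 p855246)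

set_option synthInstance.maxHeartbeats 400000 in
set_option maxHeartbeats 8000000 in
/-- **stub CAPR (E2-own, size L) — THETA-CLASS CAPTURE UNDER RIGIDITY, POSITIVELY ORIENTED** = `StubThetaClassCapture` + ONE hypothesis `ι ∈ hμ.cmType.1`
(after `HasWeight L μ 1`), under which the holomorphic theta engine ★ `exists_holTheta_atFrame_of_chiN` runs (Cases A∕C of ★ `F0P2sThetaOccursInGenOriented` ∕
`…GenNeg`: forms HOLOMORPHIC at the frame `(ι, T)` iff `ι ∈ Φ_μ`).  Plan and sources: as in the withdrawn `def` above, verbatim.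
[cite: Liu2021, Prop. 4.13 proof Case 1 (l. 2129–2137); Def. 4.12; App. D Lem. D.1, Lem. D.2 (2)] [cite: Rallis1984, Thm. 1.2.2 proof p. 356]
[cite: BorelJacquet1979, §4.6] [cite: BorelWallach2000, VI; XIII 1.2] [cite: Dixmier1977, §5.4] -/
def StubThetaClassCaptureR : Prop :=
  ∀ (L : Type) [Field L] [NumberField L] [IsCMField L] (ι : L →+* ℂ) (H : Matrix (Fin 3) (Fin 3) L) (T : GL (Fin 3) ℂ)
    (hT : (T : Matrix (Fin 3) (Fin 3) ℂ)ᴴ * H.map ι * (T : Matrix (Fin 3) (Fin 3) ℂ) = Literature.Geometry.ComplexHyperbolic.BallModel.J),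
    (∀ τ' : L →+* ℂ, InfinitePlace.mk τ' ≠ InfinitePlace.mk ι → (H.map τ').PosDef) → 2 ≤ Module.finrank ℚ ↥(maximalRealSubfield L) →
    ∀ {n' : ℕ} (e₁ : Fin 3 × Fin 1 ≃ Fin n') (dV : Fin 3 → L) (hdV : ∀ i, IsCMField.complexConj L (dV i) = dV i)
      (hdV0 : ∀ i, dV i ≠ 0) (g : GL (Fin 3) L)
      (hg : ((g : Matrix (Fin 3) (Fin 3) L).map (cmConjRingHom L))ᵀ * H * (g : Matrix (Fin 3) (Fin 3) L) = Matrix.diagonal dV)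
      (ιA : (adelicGroupData (↥(maximalRealSubfield L)) L (IsCMField.complexConj L) 3 H).Adelic →*
          ↥(UnitaryGroup.adelic (↥(maximalRealSubfield L)) L (IsCMField.complexConj L) 3 (Matrix.diagonal dV))),
        (∀ k, ((ιA k : ↥(UnitaryGroup.adelic (↥(maximalRealSubfield L)) L (IsCMField.complexConj L) 3 (Matrix.diagonal dV))) :
              GL (Fin 3) (AdeleRing (𝓞 L) L)) =
            (toAdeleGL L g)⁻¹ * adelicVal (↥(maximalRealSubfield L)) L (IsCMField.complexConj L) 3 H k * toAdeleGL L g) →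
      ∀ (ιV : finAdelic (↥(maximalRealSubfield L)) L (IsCMField.complexConj L) 3 H →*
          finAdelic (↥(maximalRealSubfield L)) L (IsCMField.complexConj L) 3 (Matrix.diagonal dV)),
        (∀ k, ((ιV k : finAdelic (↥(maximalRealSubfield L)) L (IsCMField.complexConj L) 3 (Matrix.diagonal dV)) :
            GL (Fin 3) (FiniteAdeleRing (𝓞 L) L)) =
          (toFinAdeleGL L 3 g)⁻¹ * (k : GL (Fin 3) (FiniteAdeleRing (𝓞 L) L)) * toFinAdeleGL L 3 g) →
      ∀ [CompactSpace (↥(UnitaryGroup.adelic (↥(maximalRealSubfield L)) L (IsCMField.complexConj L) 3 (Matrix.diagonal dV)) ⧸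
          (UnitaryGroup.toAdelic (↥(maximalRealSubfield L)) L (IsCMField.complexConj L) 3 (Matrix.diagonal dV)).range)],
      ∀ (μA : Measure (adelicGroupData (↥(maximalRealSubfield L)) L (IsCMField.complexConj L) 3 H).automorphicQuotient)
        [(adelicGroupData (↥(maximalRealSubfield L)) L (IsCMField.complexConj L) 3 H).IsAutomorphicMeasure μA]
        (P : DiscreteAutomorphicRep (adelicGroupData (↥(maximalRealSubfield L)) L (IsCMField.complexConj L) 3 H) μA),
        P.IsHolCotangentAt (cmArchSection L ι H T hT) (cmCompactFactor L ι H T hT) →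
        ∀ (μ : Literature.NumberTheory.Automorphic.IdeleClassGroup L →ₜ* Circle) (hμ : IsConjugateSymplectic L μ), HasWeight L μ 1 →
          ι ∈ hμ.cmType.1 →
          ∀ (a : (↥(maximalRealSubfield L))ˣ) (χ : Chi (↥(maximalRealSubfield L)) L (IsCMField.complexConj L)),
            IsAdmissibleElement L hμ.cmType.1 (algebraMap (↥(maximalRealSubfield L)) L a * (2 * imagUnit L)⁻¹) →
            P.HasFinComponent
              (rhoAtLine (↥(maximalRealSubfield L)) L (IsCMField.complexConj L) 3 e₁ (Matrix.diagonal dV)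
                (complexConj_imagUnit L) (imagUnit_ne_zero L) (imagUnit_mul_self L) (realDiagonal_isSymm L dV hdV)
                (isUnit_det_realDiagonal L dV hdV hdV0) (realDiagonal_map L dV hdV).symm
                (fun a => isCompatible_chiSplittingLine L e₁ dV hdV hdV0 (toHeckeCharacter L μ)
                  (isUnitary_toHeckeCharacter L μ) ((isOscillatorChar_toHeckeCharacter_iff μ).mpr hμ)
                  (TW (↥(maximalRealSubfield L)) a) (isSymm_TW (↥(maximalRealSubfield L)) a)
                  (isUnit_det_TW (↥(maximalRealSubfield L)) a) (JW (↥(maximalRealSubfield L)) L a)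
                  (JW_eq (↥(maximalRealSubfield L)) L a)) ιV a χ) →
            (∀ P' : DiscreteAutomorphicRep (adelicGroupData (↥(maximalRealSubfield L)) L (IsCMField.complexConj L) 3 H) μA,
                P'.IsHolCotangentAt (cmArchSection L ι H T hT) (cmCompactFactor L ι H T hT) →
                P'.HasFinComponent
                  (rhoAtLine (↥(maximalRealSubfield L)) L (IsCMField.complexConj L) 3 e₁ (Matrix.diagonal dV)
                    (complexConj_imagUnit L) (imagUnit_ne_zero L) (imagUnit_mul_self L) (realDiagonal_isSymm L dV hdV)
                    (isUnit_det_realDiagonal L dV hdV hdV0) (realDiagonal_map L dV hdV).symm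
                    (fun a => isCompatible_chiSplittingLine L e₁ dV hdV hdV0 (toHeckeCharacter L μ)
                      (isUnitary_toHeckeCharacter L μ) ((isOscillatorChar_toHeckeCharacter_iff μ).mpr hμ)
                      (TW (↥(maximalRealSubfield L)) a) (isSymm_TW (↥(maximalRealSubfield L)) a)
                      (isUnit_det_TW (↥(maximalRealSubfield L)) a) (JW (↥(maximalRealSubfield L)) L a)
                      (JW_eq (↥(maximalRealSubfield L)) L a)) ιV a χ) →
                P' = P) →
            MeetsThetaLiftFromLine L 3 H e₁ dV hdV hdV0 P μ hμ a ιA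


section StubR12
open scoped Kronecker ENNReal SchwartzMap Classical
open MulAction
open Literature.Geometry.ComplexHyperbolic.BallModel (U21 x₀)
open Literature.AlgebraicGeometry.ShimuraVarieties (BallForms.isPullbackCocycle_cotangentCocycle)
open Summit.HodgeConjecture.HodgeConjecture.Cruxes.H413
open Literature.NumberTheory.Automorphic.UnitaryGroup.CotangentForms
open Literature.NumberTheory.Automorphic.Liu2021.Def411WeilCarriers Literature.NumberTheory.Automorphic.Liu2021.Def411WeilCarriersDoubling
open Literature.NumberTheory.Automorphic.IdeleClassGroup
open Literature.NumberTheory.GelbartRogawski1991 Literature.NumberTheory.GelbartRogawski1991.UnitaryDualPair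
open Literature.NumberTheory.GelbartRogawski1991.UnitaryDualPair.WeilCoinv
open Literature.NumberTheory.Weil1964
open Literature.RepresentationTheory Literature.RepresentationTheory.Liu2021 Literature.RepresentationTheory.CompactGroups
open Summit.HodgeConjecture.CorCM Summit.HodgeConjecture.CorCM.Transposition

set_option synthInstance.maxHeartbeats 400000 in
set_option maxHeartbeats 16000000 in
/-- **stub R12 «HOL THETA WITNESS, ORIENTED» (ED. 6) — THE E2 LETTER OF THE LINE = tier-1 socket #12R `Capture.sig_K2E2CapHolThetaWitnessOriented`
VERBATIM (holder K2E2-p12; residual (α) = archimedean theta-pair inputs at a general real frame, [KonnoKonno2007, Thm. 5.4], [Liu2021, Lem. D.2 (2)]).**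
From ED. 6 on, the former E2-own stub CAPR `stub_thetaClassCaptureR` is ★ CLOSED MODULO THIS STUB by socket #13R's fold
`K2E2CapThetaClassCaptureOriented.capThetaClassCaptureOriented_of` (p855041) and socket #10 `K2E2L2MemOfProjectionRigidity.memOfProjectionRigidity` (p854820):
positively oriented (`ι ∈ Φ_μ`) admissible weight-one `(μ, a, χ)` at the TEL frame with pinned `ιA` ∕ `ιV`, `[U(diag dV)]` compact, automorphic `μA` ⟹ a pinned
theta class `θ ≠ 0` in `L²` all of whose receivers `P′` (`pr_{P′} θ ≠ 0`) are hol-cotangent at `(ι,T)` with `P′.HasFinComponent ω_H(μ,a,χ)[ιV]`.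
[cite: Liu2021, Prop. 4.13 proof Case 1 (l. 2129–2140); App. D Lem. D.2 (2) (l. 5279–5289); Def. 4.11] [cite: GelbartRogawski1991, §3 (3.2)–(3.4); Thm. 5.1.1]
[cite: KonnoKonno2007, Thm. 5.4] [cite: Rallis1984, Thm. 1.2.2] -/
def StubHolThetaWitnessOriented : Prop :=
    ∀ (L : Type) [Field L] [NumberField L] [IsCMField L] (ι : L →+* ℂ) (H : Matrix (Fin 3) (Fin 3) L) (T : GL (Fin 3) ℂ)
      (hT : (T : Matrix (Fin 3) (Fin 3) ℂ)ᴴ * H.map ι * (T : Matrix (Fin 3) (Fin 3) ℂ) = Literature.Geometry.ComplexHyperbolic.BallModel.J),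
      (∀ τ' : L →+* ℂ, InfinitePlace.mk τ' ≠ InfinitePlace.mk ι → (H.map τ').PosDef) → 2 ≤ Module.finrank ℚ ↥(maximalRealSubfield L) →
      ∀ {n' : ℕ} (e₁ : Fin 3 × Fin 1 ≃ Fin n') (dV : Fin 3 → L) (hdV : ∀ i, IsCMField.complexConj L (dV i) = dV i)
        (hdV0 : ∀ i, dV i ≠ 0) (g : GL (Fin 3) L)
        (hg : ((g : Matrix (Fin 3) (Fin 3) L).map (cmConjRingHom L))ᵀ * H * (g : Matrix (Fin 3) (Fin 3) L) = Matrix.diagonal dV)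
        (ιA : (adelicGroupData (↥(maximalRealSubfield L)) L (IsCMField.complexConj L) 3 H).Adelic →*
            ↥(UnitaryGroup.adelic (↥(maximalRealSubfield L)) L (IsCMField.complexConj L) 3 (Matrix.diagonal dV))),
          (∀ k, ((ιA k : ↥(UnitaryGroup.adelic (↥(maximalRealSubfield L)) L (IsCMField.complexConj L) 3 (Matrix.diagonal dV))) :
                GL (Fin 3) (AdeleRing (𝓞 L) L)) =
              (toAdeleGL L g)⁻¹ * adelicVal (↥(maximalRealSubfield L)) L (IsCMField.complexConj L) 3 H k * toAdeleGL L g) →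
        ∀ (ιV : finAdelic (↥(maximalRealSubfield L)) L (IsCMField.complexConj L) 3 H →*
            finAdelic (↥(maximalRealSubfield L)) L (IsCMField.complexConj L) 3 (Matrix.diagonal dV)),
          (∀ k, ((ιV k : finAdelic (↥(maximalRealSubfield L)) L (IsCMField.complexConj L) 3 (Matrix.diagonal dV)) :
              GL (Fin 3) (FiniteAdeleRing (𝓞 L) L)) =
            (toFinAdeleGL L 3 g)⁻¹ * (k : GL (Fin 3) (FiniteAdeleRing (𝓞 L) L)) * toFinAdeleGL L 3 g) →
        ∀ [CompactSpace (↥(UnitaryGroup.adelic (↥(maximalRealSubfield L)) L (IsCMField.complexConj L) 3 (Matrix.diagonal dV)) ⧸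
            (UnitaryGroup.toAdelic (↥(maximalRealSubfield L)) L (IsCMField.complexConj L) 3 (Matrix.diagonal dV)).range)],
        ∀ (μA : Measure (adelicGroupData (↥(maximalRealSubfield L)) L (IsCMField.complexConj L) 3 H).automorphicQuotient)
          [(adelicGroupData (↥(maximalRealSubfield L)) L (IsCMField.complexConj L) 3 H).IsAutomorphicMeasure μA]
          (μ : Literature.NumberTheory.Automorphic.IdeleClassGroup L →ₜ* Circle) (hμ : IsConjugateSymplectic L μ), HasWeight L μ 1 →
          ι ∈ hμ.cmType.1 →
          ∀ (a : (↥(maximalRealSubfield L))ˣ) (χ : Chi (↥(maximalRealSubfield L)) L (IsCMField.complexConj L)),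
            IsAdmissibleElement L hμ.cmType.1 (algebraMap (↥(maximalRealSubfield L)) L a * (2 * imagUnit L)⁻¹) →
            letI : MeasurableSpace (↥(UnitaryGroup.adelic (↥(maximalRealSubfield L)) L (IsCMField.complexConj L) 1
                (JW (↥(maximalRealSubfield L)) L a)) ⧸
                  (UnitaryGroup.toAdelic (↥(maximalRealSubfield L)) L (IsCMField.complexConj L) 1 (JW (↥(maximalRealSubfield L)) L a)).range) :=
              borel _
            ∃ (hρ : HasThetaMajorants fun
                (p : ↥(UnitaryGroup.adelic (↥(maximalRealSubfield L)) L (IsCMField.complexConj L) 3 (Matrix.diagonal dV)) ×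
                  ↥(UnitaryGroup.adelic (↥(maximalRealSubfield L)) L (IsCMField.complexConj L) 1 (JW (↥(maximalRealSubfield L)) L a)))
                (Φ : piSchwartzBruhat (↥(maximalRealSubfield L)) (Fin n')) =>
                  pairRep (↥(maximalRealSubfield L)) L (IsCMField.complexConj L) 3 1 e₁ (Matrix.diagonal dV) (JW (↥(maximalRealSubfield L)) L a)
                    (chiSplittingLine L e₁ dV hdV hdV0 (toHeckeCharacter L μ) (isUnitary_toHeckeCharacter L μ)
                      ((isOscillatorChar_toHeckeCharacter_iff μ).mpr hμ) (TW (↥(maximalRealSubfield L)) a)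
                      (isUnit_det_TW (↥(maximalRealSubfield L)) a) (JW (↥(maximalRealSubfield L)) L a) (JW_eq (↥(maximalRealSubfield L)) L a))
                    p Φ)
              (μW : Measure (↥(UnitaryGroup.adelic (↥(maximalRealSubfield L)) L (IsCMField.complexConj L) 1
                (JW (↥(maximalRealSubfield L)) L a)) ⧸
                  (UnitaryGroup.toAdelic (↥(maximalRealSubfield L)) L (IsCMField.complexConj L) 1 (JW (↥(maximalRealSubfield L)) L a)).range))
              (_ : IsFiniteMeasure μW)
              (_ : SMulInvariantMeasure
                (↥(UnitaryGroup.adelic (↥(maximalRealSubfield L)) L (IsCMField.complexConj L) 1 (JW (↥(maximalRealSubfield L)) L a)))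
                (↥(UnitaryGroup.adelic (↥(maximalRealSubfield L)) L (IsCMField.complexConj L) 1 (JW (↥(maximalRealSubfield L)) L a)) ⧸
                  (UnitaryGroup.toAdelic (↥(maximalRealSubfield L)) L (IsCMField.complexConj L) 1 (JW (↥(maximalRealSubfield L)) L a)).range)
                μW)
              (f : C(↥(UnitaryGroup.adelic (↥(maximalRealSubfield L)) L (IsCMField.complexConj L) 1 (JW (↥(maximalRealSubfield L)) L a)) ⧸
                (UnitaryGroup.toAdelic (↥(maximalRealSubfield L)) L (IsCMField.complexConj L) 1 (JW (↥(maximalRealSubfield L)) L a)).range, ℂ))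
              (Φ : piSchwartzBruhat (↥(maximalRealSubfield L)) (Fin n'))
              (hθ : MemLp (toQuotFun (adelicGroupData (↥(maximalRealSubfield L)) L (IsCMField.complexConj L) 3 H) fun x =>
                (lineThetaKernelDatum L 3 e₁ dV hdV hdV0 μ hμ a hρ).thetaLiftFun μW Φ f (ιA x)) 2 μA),
              MemLp.toLp _ hθ ≠ 0 ∧
              ∀ P' : DiscreteAutomorphicRep (adelicGroupData (↥(maximalRealSubfield L)) L (IsCMField.complexConj L) 3 H) μA,
                P'.space.toSubmodule.starProjection (MemLp.toLp _ hθ) ≠ 0 →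
                P'.IsHolCotangentAt (cmArchSection L ι H T hT) (cmCompactFactor L ι H T hT) ∧
                P'.HasFinComponent
                  (rhoAtLine (↥(maximalRealSubfield L)) L (IsCMField.complexConj L) 3 e₁ (Matrix.diagonal dV)
                    (complexConj_imagUnit L) (imagUnit_ne_zero L) (imagUnit_mul_self L) (realDiagonal_isSymm L dV hdV)
                    (isUnit_det_realDiagonal L dV hdV hdV0) (realDiagonal_map L dV hdV).symm
                    (fun a => isCompatible_chiSplittingLine L e₁ dV hdV hdV0 (toHeckeCharacter L μ)
                      (isUnitary_toHeckeCharacter L μ) ((isOscillatorChar_toHeckeCharacter_iff μ).mpr hμ)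
                      (TW (↥(maximalRealSubfield L)) a) (isSymm_TW (↥(maximalRealSubfield L)) a)
                      (isUnit_det_TW (↥(maximalRealSubfield L)) a) (JW (↥(maximalRealSubfield L)) L a)
                      (JW_eq (↥(maximalRealSubfield L)) L a)) ιV a χ)

set_option synthInstance.maxHeartbeats 400000 in
set_option maxHeartbeats 16000000 in
/-- **stub ARCH «ARCH-ROWS-GEN» (ED. 7; from ED. 8 on ★ CLOSED MODULO ARCH-PAIR-HOLCOT by p855525 ∘ p855623) — the ONE named archimedean input of the E2 line = tier-1 socket #20 `Capture.sig_K2E2CapArchRowsGen` = hypothesis `hA` of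
★ p855353 VERBATIM: harmonic ∕ holomorphic ∕ `U(W_a)(ℝ)`-fixed Gaussian theta PAIR at a general real frame `dV` ([KonnoKonno2007, Thm. 5.4], [Liu2021, App. D Lem. D.2 (2)]).
BOOKING CANDIDATE (chair): tier −1 named input like E1′∕E2′, or XL socket (holder K2E2-p12).  From ED. 7 on, R12 is ★ CLOSED MODULO ARCH and CAPR ★ modulo R12, so the
E2-own residue of #113 is exactly {ARCH}.
[cite: KonnoKonno2007, Thm. 5.4] [cite: Liu2021, App. D Lem. D.2 (2) (l. 5279–5289); §D.1 Step 3] [cite: GelbartRogawski1991, §3 (3.2)–(3.4)] -/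
def StubArchRowsGen : Prop :=
      ∀ (L : Type) [Field L] [NumberField L] [IsCMField L] (ι : L →+* ℂ) (H : Matrix (Fin 3) (Fin 3) L) (T : GL (Fin 3) ℂ)
        (hT : (T : Matrix (Fin 3) (Fin 3) ℂ)ᴴ * H.map ι * (T : Matrix (Fin 3) (Fin 3) ℂ) = Literature.Geometry.ComplexHyperbolic.BallModel.J),
        (∀ τ' : L →+* ℂ, InfinitePlace.mk τ' ≠ InfinitePlace.mk ι → (H.map τ').PosDef) → 2 ≤ Module.finrank ℚ ↥(maximalRealSubfield L) →
        ∀ {n' : ℕ} (e₁ : Fin 3 × Fin 1 ≃ Fin n') (dV : Fin 3 → L) (hdV : ∀ i, IsCMField.complexConj L (dV i) = dV i)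
          (hdV0 : ∀ i, dV i ≠ 0) (g : GL (Fin 3) L)
          (hg : ((g : Matrix (Fin 3) (Fin 3) L).map (cmConjRingHom L))ᵀ * H * (g : Matrix (Fin 3) (Fin 3) L) = Matrix.diagonal dV)
          (ιV : finAdelic (↥(maximalRealSubfield L)) L (IsCMField.complexConj L) 3 H →*
              finAdelic (↥(maximalRealSubfield L)) L (IsCMField.complexConj L) 3 (Matrix.diagonal dV)),
            (∀ k, ((ιV k : finAdelic (↥(maximalRealSubfield L)) L (IsCMField.complexConj L) 3 (Matrix.diagonal dV)) :
                GL (Fin 3) (FiniteAdeleRing (𝓞 L) L)) =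
              (toFinAdeleGL L 3 g)⁻¹ * (k : GL (Fin 3) (FiniteAdeleRing (𝓞 L) L)) * toFinAdeleGL L 3 g) →
          ∀ [CompactSpace (↥(UnitaryGroup.adelic (↥(maximalRealSubfield L)) L (IsCMField.complexConj L) 3 (Matrix.diagonal dV)) ⧸
              (UnitaryGroup.toAdelic (↥(maximalRealSubfield L)) L (IsCMField.complexConj L) 3 (Matrix.diagonal dV)).range)],
          ∀ (μ : Literature.NumberTheory.Automorphic.IdeleClassGroup L →ₜ* Circle) (hμ : IsConjugateSymplectic L μ), HasWeight L μ 1 →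
            ι ∈ hμ.cmType.1 →
          ∀ (a : (↥(maximalRealSubfield L))ˣ) (χ : Chi (↥(maximalRealSubfield L)) L (IsCMField.complexConj L)),
              IsAdmissibleElement L hμ.cmType.1 (algebraMap (↥(maximalRealSubfield L)) L a * (2 * imagUnit L)⁻¹) →
              letI : MeasurableSpace (↥(UnitaryGroup.adelic (↥(maximalRealSubfield L)) L (IsCMField.complexConj L) 1
                  (JW (↥(maximalRealSubfield L)) L a)) ⧸
                    (UnitaryGroup.toAdelic (↥(maximalRealSubfield L)) L (IsCMField.complexConj L) 1 (JW (↥(maximalRealSubfield L)) L a)).range) :=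
                borel _
              ∃ (hρ : HasThetaMajorants fun
                  (p : ↥(UnitaryGroup.adelic (↥(maximalRealSubfield L)) L (IsCMField.complexConj L) 3 (Matrix.diagonal dV)) ×
                    ↥(UnitaryGroup.adelic (↥(maximalRealSubfield L)) L (IsCMField.complexConj L) 1 (JW (↥(maximalRealSubfield L)) L a)))
                  (Φ : piSchwartzBruhat (↥(maximalRealSubfield L)) (Fin n')) =>
                    pairRep (↥(maximalRealSubfield L)) L (IsCMField.complexConj L) 3 1 e₁ (Matrix.diagonal dV) (JW (↥(maximalRealSubfield L)) L a)
                      (chiSplittingLine L e₁ dV hdV hdV0 (toHeckeCharacter L μ) (isUnitary_toHeckeCharacter L μ)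
                        ((isOscillatorChar_toHeckeCharacter_iff μ).mpr hμ) (TW (↥(maximalRealSubfield L)) a)
                        (isUnit_det_TW (↥(maximalRealSubfield L)) a) (JW (↥(maximalRealSubfield L)) L a) (JW_eq (↥(maximalRealSubfield L)) L a))
                      p Φ)
                (μW : Measure (↥(UnitaryGroup.adelic (↥(maximalRealSubfield L)) L (IsCMField.complexConj L) 1
                  (JW (↥(maximalRealSubfield L)) L a)) ⧸
                    (UnitaryGroup.toAdelic (↥(maximalRealSubfield L)) L (IsCMField.complexConj L) 1 (JW (↥(maximalRealSubfield L)) L a)).range))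
                (_ : IsFiniteMeasure μW)
                (_ : SMulInvariantMeasure
                  (↥(UnitaryGroup.adelic (↥(maximalRealSubfield L)) L (IsCMField.complexConj L) 1 (JW (↥(maximalRealSubfield L)) L a)))
                  (↥(UnitaryGroup.adelic (↥(maximalRealSubfield L)) L (IsCMField.complexConj L) 1 (JW (↥(maximalRealSubfield L)) L a)) ⧸
                    (UnitaryGroup.toAdelic (↥(maximalRealSubfield L)) L (IsCMField.complexConj L) 1 (JW (↥(maximalRealSubfield L)) L a)).range)
                  μW)
                (_ : μW.IsOpenPosMeasure)
                (φ : Fin 2 → 𝓢(((Fin 3 × Fin 1) → NumberField.mixedEmbedding.mixedSpace ↥(maximalRealSubfield L)), ℂ)) (j₀ : Fin 2),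
                -- the rows (W) ∧ (K) ∧ (H) ∧ (R^∞φ_{j₀} ≠ 0) ∧ (E):
                -- (W) the cotangent `K_∞`-type along `cmArchSection`
                (haveI := normal_range_toAdelic_JW L a
                 ∀ (Φf : FinSB (↥(maximalRealSubfield L)) (Fin 3 × Fin 1)) (k : ↥(stabilizer (↥U21) x₀))
                    (x : (adelicGroupData (↥(maximalRealSubfield L)) L (IsCMField.complexConj L) 3 H).Adelic),
                    (fun (j : Fin 2) =>
                      (lineThetaKernelDatum L 3 e₁ dV hdV hdV0 μ hμ a hρ).thetaLiftFun μW
                        (piSBReindex (↥(maximalRealSubfield L)) e₁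
                          (piSchwartzBruhatEquiv (↥(maximalRealSubfield L)) (Fin 3 × Fin 1) (φ j ⊗ₜ[ℂ] Φf)))
                        (charCM (chiQuot (↥(maximalRealSubfield L)) L (IsCMField.complexConj L) (Algebra.IsQuadraticExtension.finrank_eq_two _ L)
                          (IsCMField.complexConj_ne_one (K := L)) a χ))
                        ((cmAdelicFrameTransport L 3 H dV g hg) (x * ((cmArchSection L ι H T hT).comp (stabilizer (↥U21) x₀).subtype) k))) =
                      (BallForms.isPullbackCocycle_cotangentCocycle.weightOf x₀) k⁻¹ ((fun (j : Fin 2) =>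
                      (lineThetaKernelDatum L 3 e₁ dV hdV hdV0 μ hμ a hρ).thetaLiftFun μW
                        (piSBReindex (↥(maximalRealSubfield L)) e₁
                          (piSchwartzBruhatEquiv (↥(maximalRealSubfield L)) (Fin 3 × Fin 1) (φ j ⊗ₜ[ℂ] Φf)))
                        (charCM (chiQuot (↥(maximalRealSubfield L)) L (IsCMField.complexConj L) (Algebra.IsQuadraticExtension.finrank_eq_two _ L)
                          (IsCMField.complexConj_ne_one (K := L)) a χ))
                        ((cmAdelicFrameTransport L 3 H dV g hg) x)))) ∧
                -- (K) invariance under the compact archimedean factor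
                (haveI := normal_range_toAdelic_JW L a
                 ∀ (Φf : FinSB (↥(maximalRealSubfield L)) (Fin 3 × Fin 1)), ∀ k ∈ cmCompactFactor L ι H T hT,
                    ∀ (x : (adelicGroupData (↥(maximalRealSubfield L)) L (IsCMField.complexConj L) 3 H).Adelic),
                    (fun (j : Fin 2) =>
                      (lineThetaKernelDatum L 3 e₁ dV hdV hdV0 μ hμ a hρ).thetaLiftFun μW
                        (piSBReindex (↥(maximalRealSubfield L)) e₁
                          (piSchwartzBruhatEquiv (↥(maximalRealSubfield L)) (Fin 3 × Fin 1) (φ j ⊗ₜ[ℂ] Φf)))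
                        (charCM (chiQuot (↥(maximalRealSubfield L)) L (IsCMField.complexConj L) (Algebra.IsQuadraticExtension.finrank_eq_two _ L)
                          (IsCMField.complexConj_ne_one (K := L)) a χ))
                        ((cmAdelicFrameTransport L 3 H dV g hg) (x * k))) = (fun (j : Fin 2) =>
                      (lineThetaKernelDatum L 3 e₁ dV hdV hdV0 μ hμ a hρ).thetaLiftFun μW
                        (piSBReindex (↥(maximalRealSubfield L)) e₁
                          (piSchwartzBruhatEquiv (↥(maximalRealSubfield L)) (Fin 3 × Fin 1) (φ j ⊗ₜ[ℂ] Φf)))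
                        (charCM (chiQuot (↥(maximalRealSubfield L)) L (IsCMField.complexConj L) (Algebra.IsQuadraticExtension.finrank_eq_two _ L)
                          (IsCMField.complexConj_ne_one (K := L)) a χ))
                        ((cmAdelicFrameTransport L 3 H dV g hg) x))) ∧
                -- (H) holomorphic germs along `cmArchSection`
                (haveI := normal_range_toAdelic_JW L a
                 ∀ (Φf : FinSB (↥(maximalRealSubfield L)) (Fin 3 × Fin 1)),
                    IsHolGerm (cmArchSection L ι H T hT) ((fun (x : (adelicGroupData (↥(maximalRealSubfield L)) L (IsCMField.complexConj L) 3 H).Adelic) (j : Fin 2) =>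
                      (lineThetaKernelDatum L 3 e₁ dV hdV hdV0 μ hμ a hρ).thetaLiftFun μW
                        (piSBReindex (↥(maximalRealSubfield L)) e₁
                          (piSchwartzBruhatEquiv (↥(maximalRealSubfield L)) (Fin 3 × Fin 1) (φ j ⊗ₜ[ℂ] Φf)))
                        (charCM (chiQuot (↥(maximalRealSubfield L)) L (IsCMField.complexConj L) (Algebra.IsQuadraticExtension.finrank_eq_two _ L)
                          (IsCMField.complexConj_ne_one (K := L)) a χ))
                        ((cmAdelicFrameTransport L 3 H dV g hg) x)))) ∧
                -- the archimedean vector `R^∞_{e₁} φ_{j₀}` is non-zero …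
                schwartzReindexCLM (↥(maximalRealSubfield L)) e₁ (φ j₀) ≠ 0 ∧
                -- (E) … and FIXED by `U(⟨a⟩)(L⁺ ⊗ ℝ)` under the archimedean Weil representation at the `μ`-splitting
                (∀ a' : UnitaryGroup.arch (↥(maximalRealSubfield L)) L (IsCMField.complexConj L) 1 (JW (↥(maximalRealSubfield L)) L a),
                  HodgeCM.Model.HypCensus.archWeilRep (↥(maximalRealSubfield L)) L (IsCMField.complexConj L) 3 1 (Matrix.diagonal dV)
                    (JW (↥(maximalRealSubfield L)) L a) (complexConj_imagUnit L) (imagUnit_ne_zero L) (imagUnit_mul_self L) (realDiagonal_isSymm L dV hdV)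
                    (isSymm_TW (↥(maximalRealSubfield L)) a) (isUnit_det_realDiagonal L dV hdV hdV0) (isUnit_det_TW (↥(maximalRealSubfield L)) a)
                    (realDiagonal_map L dV hdV).symm (JW_eq (↥(maximalRealSubfield L)) L a) e₁
                    (chiSplittingLine L e₁ dV hdV hdV0 (toHeckeCharacter L μ) (isUnitary_toHeckeCharacter L μ)
                      ((isOscillatorChar_toHeckeCharacter_iff μ).mpr hμ) (TW (↥(maximalRealSubfield L)) a)
                      (isUnit_det_TW (↥(maximalRealSubfield L)) a) (JW (↥(maximalRealSubfield L)) L a) (JW_eq (↥(maximalRealSubfield L)) L a))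
                    (ThetaNonvanishing.proj_apply_eq_toSp (↥(maximalRealSubfield L)) L (IsCMField.complexConj L) 3 1 e₁ (Matrix.diagonal dV)
                      (JW (↥(maximalRealSubfield L)) L a) (complexConj_imagUnit L) (imagUnit_ne_zero L) (imagUnit_mul_self L) (realDiagonal_isSymm L dV hdV)
                      (isSymm_TW (↥(maximalRealSubfield L)) a) (isUnit_det_realDiagonal L dV hdV hdV0) (isUnit_det_TW (↥(maximalRealSubfield L)) a)
                      (realDiagonal_map L dV hdV).symm (JW_eq (↥(maximalRealSubfield L)) L a)
                      (isCompatible_chiSplittingLine L e₁ dV hdV hdV0 (toHeckeCharacter L μ) (isUnitary_toHeckeCharacter L μ)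
                        ((isOscillatorChar_toHeckeCharacter_iff μ).mpr hμ) (TW (↥(maximalRealSubfield L)) a) (isSymm_TW (↥(maximalRealSubfield L)) a)
                        (isUnit_det_TW (↥(maximalRealSubfield L)) a) (JW (↥(maximalRealSubfield L)) L a) (JW_eq (↥(maximalRealSubfield L)) L a)))
                    (1, a') (schwartzReindexCLM (↥(maximalRealSubfield L)) e₁ (φ j₀)) = schwartzReindexCLM (↥(maximalRealSubfield L)) e₁ (φ j₀))

set_option synthInstance.maxHeartbeats 400000 in
set_option maxHeartbeats 16000000 in
/-- **stub ARCH-PAIR-HOLCOT (ED. 8) — THE ONE OPEN E2-OWN LEAF of the line = tier-1 socket #20a `Capture.sig_K2E2CapArchPairHolCot` = hypothesis `hP` of ★ p855623 `K2E2CapArchPairHolCot.archRowsAllData_of_pairHolCot` VERBATIM (K2E2-p12's `ARCH-PAIR-HOLCOT.txt`, ws-sha16 3efc5e019e17f8df; line lead K2E2-p12).**  At every TEL frame with `ι ∈ hμ.cmType.1`, weight-one `μ`, `a(2δ)⁻¹` `Φ_μ`-admissible, `χ`, and for ALL theta data `(hρ, μ_W)`: a PAIR of archimedean Schwartz functions `φ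 : Fin 2 → 𝓢(…)` and `j₀` with (HOLCOT) every theta pair `x ↦ (j ↦ Θ_{φ_j ⊗ Φ_f}(χ̃_χ)(cmAdelicFrameTransport x))` in `holCotForms … H (cmArchSection ι T) (cmCompactFactor ι T)`, `R^∞_{e₁} φ_{j₀} ≠ 0`, and (E) `R^∞_{e₁} φ_{j₀}` fixed by `U(⟨a⟩)(L⁺ ⊗ ℝ)` under the archimedean Weil representation at the `μ`-splitting.  = ARCH-ROWS-GEN with the rows (W)(K)(H) of ★ B⁗ folded into B⁗'s membership conclusion and the theta data universally quantified (★ p855525 supplies the data: (F1) majorants of the frame, Haar probability on `[U(W_a)]`).  Roads for the closer `Theorems/K2E2CapArchPairHolCot.lean`: prove the rows and apply ★ `F0P2sThetaPairsCotForms.thetaPair_mem_holCotForms_of_arch`, or transport the P4 engine's model-currency membership (★ `harm_cDiag_of_CC` ∕ `hdef_cDiag_of_CC` ∕ `archLineInputAt`) through the Theorems-level helpers H1 `K2E2CapArchKernelIdentity` (function-level kernel identity model slot-0 ↔ line `thetaLiftFun` ∘ transport), H2 `K2E2CapArchMembershipTransport` (★ `F0P2sThetaOccursInArchTransport.exists_linear_frameTransport_from_pin`),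 H3 `K2E2CapArchPairFixedNeZero` ((E)+`≠ 0`: ★ `archWeilRep_one_line_eq_self_of_center`, ★ `cmArchWeilRep_one_blockFamilyOfAt_eq_inv_twistChar_smul`).  Typing risks: (R8) an archimedean `det`-twist `c(·,1)_∞` at non-canonical `ι` inside H1 (K2E2-p12 ADDENDUM 1, reported before closer bytes); sign ∕ normalisation of `mixedSpace` Gaussians at `dV`.
[cite: KonnoKonno2007, Thm. 5.4 p. 75] [cite: Liu2021, App. D Lem. D.2 (2) (l. 5279–5289); §D.1 Step 3] [cite: GelbartRogawski1991, §3 (3.2)–(3.4) p. 457] [cite: Rallis1984, Thm. 1.2.2] -/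
def StubArchPairHolCot : Prop :=
      ∀ (L : Type) [Field L] [NumberField L] [IsCMField L] (ι : L →+* ℂ) (H : Matrix (Fin 3) (Fin 3) L) (T : GL (Fin 3) ℂ)
        (hT : (T : Matrix (Fin 3) (Fin 3) ℂ)ᴴ * H.map ι * (T : Matrix (Fin 3) (Fin 3) ℂ) = Literature.Geometry.ComplexHyperbolic.BallModel.J),
        (∀ τ' : L →+* ℂ, InfinitePlace.mk τ' ≠ InfinitePlace.mk ι → (H.map τ').PosDef) → 2 ≤ Module.finrank ℚ ↥(maximalRealSubfield L) →
        ∀ {n' : ℕ} (e₁ : Fin 3 × Fin 1 ≃ Fin n') (dV : Fin 3 → L) (hdV : ∀ i, IsCMField.complexConj L (dV i) = dV i)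
          (hdV0 : ∀ i, dV i ≠ 0) (g : GL (Fin 3) L)
          (hg : ((g : Matrix (Fin 3) (Fin 3) L).map (cmConjRingHom L))ᵀ * H * (g : Matrix (Fin 3) (Fin 3) L) = Matrix.diagonal dV)
          (ιV : finAdelic (↥(maximalRealSubfield L)) L (IsCMField.complexConj L) 3 H →*
              finAdelic (↥(maximalRealSubfield L)) L (IsCMField.complexConj L) 3 (Matrix.diagonal dV)),
            (∀ k, ((ιV k : finAdelic (↥(maximalRealSubfield L)) L (IsCMField.complexConj L) 3 (Matrix.diagonal dV)) :
                GL (Fin 3) (FiniteAdeleRing (𝓞 L) L)) =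
              (toFinAdeleGL L 3 g)⁻¹ * (k : GL (Fin 3) (FiniteAdeleRing (𝓞 L) L)) * toFinAdeleGL L 3 g) →
          ∀ [CompactSpace (↥(UnitaryGroup.adelic (↥(maximalRealSubfield L)) L (IsCMField.complexConj L) 3 (Matrix.diagonal dV)) ⧸
              (UnitaryGroup.toAdelic (↥(maximalRealSubfield L)) L (IsCMField.complexConj L) 3 (Matrix.diagonal dV)).range)],
          ∀ (μ : Literature.NumberTheory.Automorphic.IdeleClassGroup L →ₜ* Circle) (hμ : IsConjugateSymplectic L μ), HasWeight L μ 1 →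
            ι ∈ hμ.cmType.1 →
          ∀ (a : (↥(maximalRealSubfield L))ˣ) (χ : Chi (↥(maximalRealSubfield L)) L (IsCMField.complexConj L)),
              IsAdmissibleElement L hμ.cmType.1 (algebraMap (↥(maximalRealSubfield L)) L a * (2 * imagUnit L)⁻¹) →
              ∀ (hρ : HasThetaMajorants fun
                  (p : ↥(UnitaryGroup.adelic (↥(maximalRealSubfield L)) L (IsCMField.complexConj L) 3 (Matrix.diagonal dV)) ×
                    ↥(UnitaryGroup.adelic (↥(maximalRealSubfield L)) L (IsCMField.complexConj L) 1 (JW (↥(maximalRealSubfield L)) L a)))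
                  (Φ : piSchwartzBruhat (↥(maximalRealSubfield L)) (Fin n')) =>
                    pairRep (↥(maximalRealSubfield L)) L (IsCMField.complexConj L) 3 1 e₁ (Matrix.diagonal dV) (JW (↥(maximalRealSubfield L)) L a)
                      (chiSplittingLine L e₁ dV hdV hdV0 (toHeckeCharacter L μ) (isUnitary_toHeckeCharacter L μ)
                        ((isOscillatorChar_toHeckeCharacter_iff μ).mpr hμ) (TW (↥(maximalRealSubfield L)) a)
                        (isUnit_det_TW (↥(maximalRealSubfield L)) a) (JW (↥(maximalRealSubfield L)) L a) (JW_eq (↥(maximalRealSubfield L)) L a))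
                      p Φ)
                [MeasurableSpace (↥(UnitaryGroup.adelic (↥(maximalRealSubfield L)) L (IsCMField.complexConj L) 1
                    (JW (↥(maximalRealSubfield L)) L a)) ⧸
                      (UnitaryGroup.toAdelic (↥(maximalRealSubfield L)) L (IsCMField.complexConj L) 1 (JW (↥(maximalRealSubfield L)) L a)).range)]
                [BorelSpace (↥(UnitaryGroup.adelic (↥(maximalRealSubfield L)) L (IsCMField.complexConj L) 1
                    (JW (↥(maximalRealSubfield L)) L a)) ⧸
                      (UnitaryGroup.toAdelic (↥(maximalRealSubfield L)) L (IsCMField.complexConj L) 1 (JW (↥(maximalRealSubfield L)) L a)).range)]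
                (μW : Measure (↥(UnitaryGroup.adelic (↥(maximalRealSubfield L)) L (IsCMField.complexConj L) 1
                  (JW (↥(maximalRealSubfield L)) L a)) ⧸
                    (UnitaryGroup.toAdelic (↥(maximalRealSubfield L)) L (IsCMField.complexConj L) 1 (JW (↥(maximalRealSubfield L)) L a)).range))
                [IsFiniteMeasure μW]
                [SMulInvariantMeasure
                  (↥(UnitaryGroup.adelic (↥(maximalRealSubfield L)) L (IsCMField.complexConj L) 1 (JW (↥(maximalRealSubfield L)) L a)))
                  (↥(UnitaryGroup.adelic (↥(maximalRealSubfield L)) L (IsCMField.complexConj L) 1 (JW (↥(maximalRealSubfield L)) L a)) ⧸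
                    (UnitaryGroup.toAdelic (↥(maximalRealSubfield L)) L (IsCMField.complexConj L) 1 (JW (↥(maximalRealSubfield L)) L a)).range)
                  μW]
                [μW.IsOpenPosMeasure],
              ∃ (φ : Fin 2 → 𝓢(((Fin 3 × Fin 1) → NumberField.mixedEmbedding.mixedSpace ↥(maximalRealSubfield L)), ℂ)) (j₀ : Fin 2),
                  -- (HOLCOT) every theta pair of `φ` read on `U(H)(𝔸)` along the canonical transport is a HOLOMORPHIC COTANGENT FORM at `(ι, T)` …
                (haveI := normal_range_toAdelic_JW L a
                 ∀ (Φf : FinSB (↥(maximalRealSubfield L)) (Fin 3 × Fin 1)),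
                    ((fun (x : (adelicGroupData (↥(maximalRealSubfield L)) L (IsCMField.complexConj L) 3 H).Adelic) (j : Fin 2) =>
                      (lineThetaKernelDatum L 3 e₁ dV hdV hdV0 μ hμ a hρ).thetaLiftFun μW
                        (piSBReindex (↥(maximalRealSubfield L)) e₁
                          (piSchwartzBruhatEquiv (↥(maximalRealSubfield L)) (Fin 3 × Fin 1) (φ j ⊗ₜ[ℂ] Φf)))
                        (charCM (chiQuot (↥(maximalRealSubfield L)) L (IsCMField.complexConj L) (Algebra.IsQuadraticExtension.finrank_eq_two _ L)
                          (IsCMField.complexConj_ne_one (K := L)) a χ))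
                        ((cmAdelicFrameTransport L 3 H dV g hg) x))) ∈
                      CotangentForms.holCotForms (↥(maximalRealSubfield L)) L (IsCMField.complexConj L) 3 H
                        (cmArchSection L ι H T hT) (cmCompactFactor L ι H T hT)) ∧
                  -- … the archimedean vector `R^∞_{e₁} φ_{j₀}` is non-zero …
                schwartzReindexCLM (↥(maximalRealSubfield L)) e₁ (φ j₀) ≠ 0 ∧
                  -- (E) … and FIXED by `U(⟨a⟩)(L⁺ ⊗ ℝ)` under the archimedean Weil representation at the `μ`-splitting
                (∀ a' : UnitaryGroup.arch (↥(maximalRealSubfield L)) L (IsCMField.complexConj L) 1 (JW (↥(maximalRealSubfield L)) L a),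
                  HodgeCM.Model.HypCensus.archWeilRep (↥(maximalRealSubfield L)) L (IsCMField.complexConj L) 3 1 (Matrix.diagonal dV)
                    (JW (↥(maximalRealSubfield L)) L a) (complexConj_imagUnit L) (imagUnit_ne_zero L) (imagUnit_mul_self L) (realDiagonal_isSymm L dV hdV)
                    (isSymm_TW (↥(maximalRealSubfield L)) a) (isUnit_det_realDiagonal L dV hdV hdV0) (isUnit_det_TW (↥(maximalRealSubfield L)) a)
                    (realDiagonal_map L dV hdV).symm (JW_eq (↥(maximalRealSubfield L)) L a) e₁
                    (chiSplittingLine L e₁ dV hdV hdV0 (toHeckeCharacter L μ) (isUnitary_toHeckeCharacter L μ)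
                      ((isOscillatorChar_toHeckeCharacter_iff μ).mpr hμ) (TW (↥(maximalRealSubfield L)) a)
                      (isUnit_det_TW (↥(maximalRealSubfield L)) a) (JW (↥(maximalRealSubfield L)) L a) (JW_eq (↥(maximalRealSubfield L)) L a))
                    (ThetaNonvanishing.proj_apply_eq_toSp (↥(maximalRealSubfield L)) L (IsCMField.complexConj L) 3 1 e₁ (Matrix.diagonal dV)
                      (JW (↥(maximalRealSubfield L)) L a) (complexConj_imagUnit L) (imagUnit_ne_zero L) (imagUnit_mul_self L) (realDiagonal_isSymm L dV hdV)
                      (isSymm_TW (↥(maximalRealSubfield L)) a) (isUnit_det_realDiagonal L dV hdV hdV0) (isUnit_det_TW (↥(maximalRealSubfield L)) a)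
                      (realDiagonal_map L dV hdV).symm (JW_eq (↥(maximalRealSubfield L)) L a)
                      (isCompatible_chiSplittingLine L e₁ dV hdV hdV0 (toHeckeCharacter L μ) (isUnitary_toHeckeCharacter L μ)
                        ((isOscillatorChar_toHeckeCharacter_iff μ).mpr hμ) (TW (↥(maximalRealSubfield L)) a) (isSymm_TW (↥(maximalRealSubfield L)) a)
                        (isUnit_det_TW (↥(maximalRealSubfield L)) a) (JW (↥(maximalRealSubfield L)) L a) (JW_eq (↥(maximalRealSubfield L)) L a)))
                    (1, a') (schwartzReindexCLM (↥(maximalRealSubfield L)) e₁ (φ j₀)) = schwartzReindexCLM (↥(maximalRealSubfield L)) e₁ (φ j₀))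

set_option synthInstance.maxHeartbeats 400000 in
set_option maxHeartbeats 16000000 in
/-- stub ARCH-PAIR-HOLCOT (ED. 9, 2026-09-04T03:52Z): socket #20a BY TEXT, ★ FOLDED BY NAME onto ★ p857161 `K2E2CapArchPairHolCot.capArchPairHolCot` (K2E2-p12 (g2) line lead). With this fold the E2 line holds NO open own stub: the remaining sorries are the four junction letters PK, E3♭, E1′, E2′ (owners K2E1 / P3). -/
theorem stub_archPairHolCot : StubArchPairHolCot :=
  @Summit.HodgeConjecture.HodgeConjecture.Cruxes.H413.K2E2CapArchPairHolCot.capArchPairHolCot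

set_option synthInstance.maxHeartbeats 400000 in
set_option maxHeartbeats 16000000 in
/-- ARCH-ROWS-GEN ★ CLOSED MODULO ARCH-PAIR-HOLCOT (ED. 8): ★ p855525 `archRowsGen_of_forall_thetaData` ∘ ★ p855623 `archRowsAllData_of_pairHolCot` BY NAME (statement bytes of `StubArchRowsGen` FROZEN). -/
theorem stub_archRowsGen : StubArchRowsGen :=
  @Summit.HodgeConjecture.HodgeConjecture.Cruxes.H413.K2E2CapArchRowsGen.archRowsGen_of_forall_thetaData
    (@Summit.HodgeConjecture.HodgeConjecture.Cruxes.H413.K2E2CapArchPairHolCot.archRowsAllData_of_pairHolCot stub_archPairHolCot)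

set_option synthInstance.maxHeartbeats 400000 in
set_option maxHeartbeats 16000000 in
/-- R12 ★ CLOSED MODULO ARCH-ROWS-GEN (ED. 8): ★ p855353 `capHolThetaWitnessOriented_of_archRowsGen` BY NAME (statement bytes of `StubHolThetaWitnessOriented` FROZEN). -/
theorem stub_holThetaWitnessOriented : StubHolThetaWitnessOriented :=
  @Summit.HodgeConjecture.HodgeConjecture.Cruxes.H413.K2E2CapHolThetaWitnessOriented.capHolThetaWitnessOriented_of_archRowsGen stub_archRowsGen

end StubR12

/-- CAPR ★ CLOSED MODULO R12 (ED. 6): socket #13R fold (p855041) ∘ socket #10 (p854820), BY NAME. -/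
theorem stub_thetaClassCaptureR : StubThetaClassCaptureR :=
  K2E2CapThetaClassCaptureOriented.capThetaClassCaptureOriented_of stub_holThetaWitnessOriented
    K2E2L2MemOfProjectionRigidity.memOfProjectionRigidity

/-! ## §3 The composition — the letter #113 BY NAME (sorry-free; `sorryAx` reaches it through the six `stub_*` only) -/

set_option synthInstance.maxHeartbeats 400000 in
set_option maxHeartbeats 16000000 in
/-- **#113 `Liu2021.cohHol_meetsThetaLiftFromLine` ⟸ PK + E3♭ + E1′ + E2′ + ADM + TR + OR + CAPR (ED. 4).**  The term: «AFA» ★ gives an irreducible admissible finite component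
`σ` of the hol-cotangent `P`; CE ⟸ PK (★ `F0P2CELocalToGlobal.stubCE_of_rung2` over ★ GL, LW, LT, CER) and (C♭) ⟸ CE (★ `F0P2cSocketC.cohFinComponentIsThetaAdm_of_CE`)
give `(μ, a, χ)` with `σ ↪ ω_H(μ,a,χ)` at the CANONICAL finite transport `ιV = finPart ∘ cmAdelicFrameTransport ∘ finAdelicToAdelic` (★, pinned by `g`); TR
(with `a′ = a`) makes `ω_H(μ,a,χ)` the finite component; E3♭ gives the parity; ADM an admissible `a′` with the same classes; TR transports the finite component
to `a′`; ORIENTATION: if `ι ∉ Φ_μ`, OR gives an ANTIholomorphic `P″` with the same irreducible smooth (★ CI) finite component, contradicting E2′ — so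
`ι ∈ Φ_μ`; E1′ is the rigidity hypothesis of CAPR; CAPR concludes.
[cite: Liu2021, Prop. 4.13 proof Case 1 (l. 2129–2146); Rem. 4.14] [cite: GelbartRogawski1991, Thm. 5.1.1 p. 465; Remark p. 466] [cite: Rogawski1992, Thm. 1.1]
[cite: Rogawski1990, Thm. 13.3.6 (c); Thm. 14.6.4] -/
theorem cohHol_meetsThetaLiftFromLine_of_line
    (hPK : F0P2CELocalToGlobal.StubPKLocalThetaClasses)
    (hE3 : F0P2E3ParityRecut.StubE3FlatAutomorphicParity)
    (hE1 : Literature.NumberTheory.Rogawski1990.cohFinComponentUnique_hol)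
    (hE2 : Literature.NumberTheory.Rogawski1990.hodgeTypeRigid)
    (hADM : StubAdmissibleRepresentative)
    (hTR : StubFinComponentTransport)
    (hOR : StubAntiholWitnessOfNeg)
    (hCAP : StubThetaClassCaptureR) :
    Literature.NumberTheory.Automorphic.Liu2021.cohHol_meetsThetaLiftFromLine := by
  intro L _ _ _ ι H T hT hpos h2 n' e₁ dV hdV hdV0 g hg ιA hιA _ μA _ P hP
  -- the canonical finite frame transport, pinned by `g` (★ `ThetaLiftFromLineCoinvariantJunction` §0)
  let ιV : finAdelic (↥(maximalRealSubfield L)) L (IsCMField.complexConj L) 3 H →*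
      finAdelic (↥(maximalRealSubfield L)) L (IsCMField.complexConj L) 3 (Matrix.diagonal dV) :=
    (finPart (↥(maximalRealSubfield L)) L (IsCMField.complexConj L) 3 (Matrix.diagonal dV)).comp
      ((cmAdelicFrameTransport L 3 H dV g hg).comp (finAdelicToAdelic (↥(maximalRealSubfield L)) L (IsCMField.complexConj L) 3 H))
  have hιV : ∀ k, ((ιV k : finAdelic (↥(maximalRealSubfield L)) L (IsCMField.complexConj L) 3 (Matrix.diagonal dV)) :
        GL (Fin 3) (FiniteAdeleRing (𝓞 L) L)) =
      (toFinAdeleGL L 3 g)⁻¹ * (k : GL (Fin 3) (FiniteAdeleRing (𝓞 L) L)) * toFinAdeleGL L 3 g :=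
    fun k => coe_finPart_cmAdelicFrameTransport_finAdelicToAdelic L 3 H dV g hg k
  -- «AFA»: an irreducible admissible finite component
  obtain ⟨W, _, _, σ, hirr, hadm, hPσ⟩ :=
    F0P3AutomorphicFlathAdmissibleOfCot.exists_irreducible_admissible_hasFinComponent_of_isHolCotangentAt ι T hT hpos h2 P hP
  -- CE ⟸ PK (★ folds of the CE line), (C♭) ⟸ CE
  have hCE : F0P2CELocalToGlobal.CETarget :=
    F0P2CELocalToGlobal.stubCE_of_rung2 hPK F0P2CELocalToGlobal.stub_GL_globalLine F0P2CELocalToGlobal.stub_LW_localWitness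
      F0P2CELocalToGlobal.stub_LT_localTypeTransport F0P2CELocalToGlobal.stub_CER_coreToCE
  obtain ⟨μ, hμ, hw, a, χ, f, hf⟩ :=
    F0P2cSocketC.cohFinComponentIsThetaAdm_of_CE hCE L ι H T hT hpos h2 e₁ dV hdV hdV0 g hg ιV hιV μA W σ hirr hadm.isSmooth hadm P
      (Or.inl hP) hPσ
  -- the finite component IS `ω_H(μ, a, χ)`; parity; admissible representative; transport
  have hPa := hTR L ι H T hT hpos h2 e₁ dV hdV hdV0 g hg ιV hιV μA W σ hirr P μ hμ a a χ hPσ ⟨f, hf⟩ rfl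
  have hEven := hE3 L ι H T hT hpos h2 e₁ dV hdV hdV0 g hg ιV hιV μA P (Or.inl hP) μ hμ hw a χ hPa
  obtain ⟨a', hcl, hadm'⟩ := hADM L μ hμ a hEven
  have hPa' := hTR L ι H T hT hpos h2 e₁ dV hdV hdV0 g hg ιV hιV μA W σ hirr P μ hμ a a' χ hPσ ⟨f, hf⟩ hcl
  -- ★ CI: `ω_H(μ, a′, χ)` irreducible and smooth
  have hρirr := F0P2cStubCI.rhoAtLine_chi_isIrreducible L H e₁ dV hdV hdV0 g hg ιV hιV μ hμ a' χ
  have hρsm := F0P2cStubCI.isSmooth_of_isSmoothRep _ (F0P2cStubCI.rhoAtLine_chi_isSmoothRep L H e₁ dV hdV hdV0 g hg ιV hιV μ hμ a' χ)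
  -- ORIENTATION (ED. 4): the label of the HOLOMORPHIC `P` is positively oriented — else OR gives an antiholomorphic carrier of `ω_H(μ, a′, χ)`, against E2′
  by_cases hι : ι ∈ hμ.cmType.1
  · -- capture under rigidity (E1′)
    refine ⟨μ, hμ, a', hCAP L ι H T hT hpos h2 e₁ dV hdV hdV0 g hg ιA hιA ιV hιV μA P hP μ hμ hw hι a' χ hadm' hPa' ?_⟩
    intro P' hP' hP'a'
    exact (hE1 L ι H T hT hpos h2 μA _ _ hρirr hρsm P P' hP hP' hPa' hP'a').symm
  · obtain ⟨P'', hP'', hP''a'⟩ := hOR L ι H T hT hpos h2 e₁ dV hdV hdV0 g hg ιA hιA ιV hιV μA μ hμ hw hι a' χ hadm'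
    exact (hE2 L ι H T hT hpos h2 μA _ _ hρirr hρsm P P'' hP hP'' hPa' hP''a').elim

/-- The letter from the registered stubs (the form the lead prover folds: `sorryAx` through the eight `stub_*` exactly — four junction letters BY NAME (PK, E3♭, E1′, E2′) and four E2-own (ADM, TR, OR, CAPR), ED. 4). -/
theorem cohHol_meetsThetaLiftFromLine_of_stubs : Literature.NumberTheory.Automorphic.Liu2021.cohHol_meetsThetaLiftFromLine :=
  cohHol_meetsThetaLiftFromLine_of_line stub_PK stub_E3flat stub_E1prime stub_E2prime stub_admissibleRepresentative stub_finComponentTransport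
    stub_antiholWitnessOfNeg stub_thetaClassCaptureR

/-! ## §4 By-name consequences (★ consumers of #113): (C♯)hol and the socket `F0HdictE` (27455) at its Theorems-side type -/

/-- (C♯)hol from the line (★ `F0P2qHdictEOfD1.cSharpHol_of_D1`). [cite: Rogawski1990, Thm. 13.3.6 (c)] [cite: Liu2021, Prop. 4.13] -/
theorem cSharpHol_of_line
    (hPK : F0P2CELocalToGlobal.StubPKLocalThetaClasses)
    (hE3 : F0P2E3ParityRecut.StubE3FlatAutomorphicParity)
    (hE1 : Literature.NumberTheory.Rogawski1990.cohFinComponentUnique_hol)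
    (hE2 : Literature.NumberTheory.Rogawski1990.hodgeTypeRigid)
    (hADM : StubAdmissibleRepresentative)
    (hTR : StubFinComponentTransport)
    (hOR : StubAntiholWitnessOfNeg)
    (hCAP : StubThetaClassCaptureR) :
    Literature.NumberTheory.Rogawski1990.cohFinComponent_isThetaSigned_hol :=
  F0P2qHdictEOfD1.cSharpHol_of_D1 (cohHol_meetsThetaLiftFromLine_of_line hPK hE3 hE1 hE2 hADM hTR hOR hCAP)

/-- The socket `F0HdictE` (stmt 27455) at its Theorems-side type `F0FloorSockets.HdictEType` from the line (★ `F0P2qHdictEOfD1.hdictEType_of_D1`).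
[cite: Liu2021, Prop. 4.13; App. D Lem. D.2] [cite: Rogawski1990, Thm. 13.3.6 (c)] -/
theorem hdictEType_of_line
    (hPK : F0P2CELocalToGlobal.StubPKLocalThetaClasses)
    (hE3 : F0P2E3ParityRecut.StubE3FlatAutomorphicParity)
    (hE1 : Literature.NumberTheory.Rogawski1990.cohFinComponentUnique_hol)
    (hE2 : Literature.NumberTheory.Rogawski1990.hodgeTypeRigid)
    (hADM : StubAdmissibleRepresentative)
    (hTR : StubFinComponentTransport)
    (hOR : StubAntiholWitnessOfNeg)
    (hCAP : StubThetaClassCaptureR) :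
    Summit.HodgeConjecture.HodgeConjecture.Theorems.F0FloorSockets.HdictEType :=
  F0P2qHdictEOfD1.hdictEType_of_D1 (cohHol_meetsThetaLiftFromLine_of_line hPK hE3 hE1 hE2 hADM hTR hOR hCAP)

/-! ## §5 CHAIR RULING R1 (c1): E3♭ BY NAME through the EXISTING hypothesis-form heads (cone-shape certificate, not a road) -/

set_option synthInstance.maxHeartbeats 400000 in
set_option maxHeartbeats 16000000 in
/-- **E3♭ `F0P2E3ParityRecut.StubE3FlatAutomorphicParity` BY NAME from the line (CHAIR RULING R1 (c1), K2/STATUS 2026-09-03T20:19:16Z).**  The chain,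
every link a sorry-free ★ head in hypothesis form (NO missing link): line ⟹ #113 (`cohHol_meetsThetaLiftFromLine_of_line`) ⟹ (C♯)hol
(★ `F0P2qHdictEOfD1.cSharpHol_of_D1`) ⟹ E3♭∞ (★ `F0P2mHdictEOfLetter.e3flatArch_of_cohFinComponent_isThetaSigned`) ⟹ E3♭ (★ HR-a fold
`F0P2lE3FlatOfArch.e3flat_of_arch`, p821653).  HONEST CONTENT NOTE: `hE3 : StubE3FlatAutomorphicParity` is itself among the six hypotheses, so this
corollary certifies the CONE SHAPE «#113 ⟹ E3♭ through ★ heads» and is NOT an independent road to E3♭ — E3♭'s road is K2E1's REL road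
(`Lines/F0_P2E3RelSign.lean` ED. 4, open input REL♯¹) or E3♭∞; see the card § Junctions.
[cite: Liu2021, Rem. 4.14; Def. 4.12] [cite: Rogawski1992, Thm. 1.1 p. 396] [cite: Omeara1963, §71 Thm. 71:18] -/
theorem e3flatAutomorphicParity_of_line
    (hPK : F0P2CELocalToGlobal.StubPKLocalThetaClasses)
    (hE3 : F0P2E3ParityRecut.StubE3FlatAutomorphicParity)
    (hE1 : Literature.NumberTheory.Rogawski1990.cohFinComponentUnique_hol)
    (hE2 : Literature.NumberTheory.Rogawski1990.hodgeTypeRigid)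
    (hADM : StubAdmissibleRepresentative)
    (hTR : StubFinComponentTransport)
    (hOR : StubAntiholWitnessOfNeg)
    (hCAP : StubThetaClassCaptureR) :
    F0P2E3ParityRecut.StubE3FlatAutomorphicParity :=
  F0P2lE3FlatOfArch.e3flat_of_arch
    (F0P2mHdictEOfLetter.e3flatArch_of_cohFinComponent_isThetaSigned (cSharpHol_of_line hPK hE3 hE1 hE2 hADM hTR hOR hCAP))

/-! ## §6 HEAD A (ED. 3) — the GENERAL-FRAME (C♯)hol and the route item `F0HdictE` from PK + E3♭ + ADM + TR ONLY (no theta exhaustion, no CAP, no E1′) -/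

set_option synthInstance.maxHeartbeats 400000 in
set_option maxHeartbeats 16000000 in
/-- **HEAD A — (C♯)hol `Rogawski1990.cohFinComponent_isThetaSigned_hol` ⟸ PK + E3♭ + ADM + TR.**  Steps 1–2 of the #113 head already produce, at an ARBITRARY
pinned finite transport `ιV` (the (C♯)hol frame quantifies over it), a weight-one conjugate-symplectic `μ`, an ADMISSIBLE representative `a′` and `χ` with
`P.HasFinComponent ω_H(μ, a′, χ)[ιV]`: «AFA» ★ (irreducible admissible finite component `σ`) → CE ⟸ PK (★ `stubCE_of_rung2` over ★ GL∕LW∕LT∕CER) → (C♭) ⟸ CE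
(★ `F0P2cSocketC.cohFinComponentIsThetaAdm_of_CE`, any pinned `ιV`) → TR (`a ↦ a`: `ω_H(μ,a,χ)` IS the finite component) → E3♭ (parity even) → ADM (admissible
`a′`, same classes) → TR (`a ↦ a′`).  CONSEQUENCE FOR THE CONE OF RECORD: the h413 floor socket `F0HdictE` (stmt 27455) and (C♯)hol follow from the junctions PK,
E3♭ and the EIGHT S-sized E2-own sockets of units ADM-REP + CLASS-TRANSPORT (`…_AdmRep`, `…_ClassTransport`) — theta EXHAUSTION (#113 proper: + CAP + E1′) is
needed only for the letter itself.  Compare ★ `F0P2cSocketC.H413_of_PK_E3flat` (pin-level, needs the floor rows `hJ3a`, `hocc`): this head is general-frame and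
uses neither.
[cite: Liu2021, Prop. 4.13 proof Case 1 (l. 2129–2146); Def. 4.12; Rem. 4.14] [cite: Rogawski1990, Thm. 13.3.6 (c); §12.3] [cite: Rogawski1992, Thm. 1.1]
[cite: GelbartRogawski1991, Lem. 5.1.2 p. 466] -/
theorem cSharpHol_of_PK_E3flat
    (hPK : F0P2CELocalToGlobal.StubPKLocalThetaClasses)
    (hE3 : F0P2E3ParityRecut.StubE3FlatAutomorphicParity)
    (hADM : StubAdmissibleRepresentative)
    (hTR : StubFinComponentTransport) :
    Literature.NumberTheory.Rogawski1990.cohFinComponent_isThetaSigned_hol := by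
  intro L _ _ _ ι H T hT hpos h2 n' e₁ dV hdV hdV0 g hg ιV hιV μA _ P hP
  -- «AFA»: an irreducible admissible finite component
  obtain ⟨W, _, _, σ, hirr, hadm, hPσ⟩ :=
    F0P3AutomorphicFlathAdmissibleOfCot.exists_irreducible_admissible_hasFinComponent_of_isHolCotangentAt ι T hT hpos h2 P hP
  -- CE ⟸ PK, (C♭) ⟸ CE at the GIVEN pinned `ιV`
  have hCE : F0P2CELocalToGlobal.CETarget :=
    F0P2CELocalToGlobal.stubCE_of_rung2 hPK F0P2CELocalToGlobal.stub_GL_globalLine F0P2CELocalToGlobal.stub_LW_localWitness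
      F0P2CELocalToGlobal.stub_LT_localTypeTransport F0P2CELocalToGlobal.stub_CER_coreToCE
  obtain ⟨μ, hμ, hw, a, χ, f, hf⟩ :=
    F0P2cSocketC.cohFinComponentIsThetaAdm_of_CE hCE L ι H T hT hpos h2 e₁ dV hdV hdV0 g hg ιV hιV μA W σ hirr hadm.isSmooth hadm P
      (Or.inl hP) hPσ
  -- finite component `ω_H(μ,a,χ)`; parity; admissible representative; transport
  have hPa := hTR L ι H T hT hpos h2 e₁ dV hdV hdV0 g hg ιV hιV μA W σ hirr P μ hμ a a χ hPσ ⟨f, hf⟩ rfl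
  have hEven := hE3 L ι H T hT hpos h2 e₁ dV hdV hdV0 g hg ιV hιV μA P (Or.inl hP) μ hμ hw a χ hPa
  obtain ⟨a', hcl, hadm'⟩ := hADM L μ hμ a hEven
  have hPa' := hTR L ι H T hT hpos h2 e₁ dV hdV hdV0 g hg ιV hιV μA W σ hirr P μ hμ a a' χ hPσ ⟨f, hf⟩ hcl
  exact ⟨μ, hμ, hw, a', χ, hadm', hPa'⟩

/-- **HEAD A, route-item form — the floor socket `F0HdictE` (stmt-HodgeConjecture-27455, `Theses.HCCMUnconditional.F0HdictE`) ⟸ PK + E3♭ + ADM + TR**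
(★ `F0P2mHdictEOfLetter.hdictE_of_cohFinComponent_isThetaSigned`, p825500, over ★ (C♯)antihol-of-hol). [cite: Liu2021, Prop. 4.13; App. D Lem. D.2] [cite: Rogawski1990, Thm. 13.3.6 (c)] -/
theorem hdictE_of_PK_E3flat
    (hPK : F0P2CELocalToGlobal.StubPKLocalThetaClasses)
    (hE3 : F0P2E3ParityRecut.StubE3FlatAutomorphicParity)
    (hADM : StubAdmissibleRepresentative)
    (hTR : StubFinComponentTransport) :
    Summit.HodgeConjecture.HodgeConjecture.Theses.HCCMUnconditional.F0HdictE :=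
  F0P2mHdictEOfLetter.hdictE_of_cohFinComponent_isThetaSigned (cSharpHol_of_PK_E3flat hPK hE3 hADM hTR)

/-- HEAD A from the registered stubs (`sorryAx` through `stub_PK`, `stub_E3flat`, `stub_admissibleRepresentative`, `stub_finComponentTransport` exactly). -/
theorem hdictE_of_stubsA : Summit.HodgeConjecture.HodgeConjecture.Theses.HCCMUnconditional.F0HdictE :=
  hdictE_of_PK_E3flat stub_PK stub_E3flat stub_admissibleRepresentative stub_finComponentTransport

end Summit.HodgeConjecture.HodgeConjecture.Cruxes.H413.K2E2ThetaExhaustionByRigidity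

end
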